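import Mathlib.MeasureTheory.Function.LpSeminorm.Count
import Literature.Analysis.FluidPDE.CriticalRegularityProofs
import Literature.Analysis.FunctionSpaces.CheminLerner
import HarnessLib

/-!
# Gallagher–Koch–Planchon: critical elements and the reduction of Theorem 1 (§2.1)

Sibling file of `Literature/Analysis/FluidPDE/CriticalRegularity.lean` (named fact
`Literature.Analysis.FluidPDE.gkp_besov_blowup` = Gallagher–Koch–Planchon 2016, Thm. 1) and of its proof file
`CriticalRegularityProofs.lean`. It vendors the **architecture of GKP's proof** (§2.1, p. 6 of
arXiv:1407.4156: "Theorem 1 is an immediate corollary of the next three statements") in the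
vocabulary of `CriticalRegularity.lean`, *proves* the corollary, and (since the verdict clean-up
of 2026-08-15, see the dedicated section below) also carries Gallagher–Koch–Planchon's **own**
solution class, in which the printed statements are to be read:

* `criticalBesovThreshold ν p` — GKP's
  `A_c := sup {A > 0 | sup_{[0,T*)} ‖NS(u₀)(t)‖_{Ḃ^{s_p}_{p,p}} ≤ A ⟹ T*(u₀) = ∞}` (§2.1), read
  over the tree's class `IsMaximalBesovMildSolution`, with `criticalBesovThreshold_eq_iInf` =
  GKP's second formula `A_c = inf {sup_{[0,T*)} ‖NS(u₀)(t)‖ | T*(u₀) < ∞}`;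
* `IsCriticalElement ν p T u U` — membership of the datum in GKP's set `𝒟_c`
  (`T* < ∞` and `sup_{[0,T*)} ‖NS(u₀)(t)‖_{Ḃ^{s_p}_{p,p}} = A_c < ∞`), over the tree's class;
* `IsGKPExponent p` — the standing assumption `p = 3·2^k - 2`, `k ≥ 2`, of §2;
* **GKP's own class** (p. 4): `IsGKPSolutionOn p q T ν u U` (`NS(u₀)` on `[0, T)`,
  `T ≤ T*(u₀)`: a Besov mild solution of the critical class `(s_p, p, q)` lying in the path
  space `𝓛^{1:∞}_{p,q}[T' < T]`, the class in which `NS(u₀)` exists and is unique, (1.5)–(1.6)),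
  `IsMaximalGKPSolution` ("`T = T*(u₀)`", (1.3)), and `A_c`, `𝒟_c` over it:
  `IsGKPGlobalityBound`, `gkpCriticalThreshold` (with `gkpCriticalThreshold_eq_iInf`),
  `IsGKPCriticalElement`;
* named facts (not proved here), all three **deprecated** (2026-08-15, mis-stated, kept verbatim
  for their users) tree-class renderings: `gkp_regularity_persistence` ((1.9) with (1.6)),
  `gkp_exists_criticalElement` (Prop. 2.1) and `gkp_criticalElement_tendsto_zero` (Prop. 2.2) —
  see the section "GKP's solution class versus the tree's class" below for what is wrong and for
  the faithful statements; the fourth rendering, `gkp_rigidity` (Prop. 2.3), was **retired** on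
  review of the decomposition (2026-08-15, same section): its statement is now the explicit
  hypothesis `h3` of the assembly theorems;
* proved: `limsup_eq_top_of_isGKPExponent` (Props. 2.1–2.3 ⟹ Thm. 1 for `p = q = 3·2^k - 2`)
  and `gkp_besov_blowup_of_criticalElements` (the full reduction of §2.1: with the Besov
  embedding (1.1) = `Literature.Analysis.FunctionSpaces.besov_embedding` plus `eHomBesovNorm_exponent_antitone`, and (1.9),
  Thm. 1 for all `3 < p, q < ∞`, i.e. the named fact `gkp_besov_blowup`), both over the
  tree's class and therefore conditional on the deprecated renderings; and the identification
  bridges `isMaximalBesovMildSolution_iff_isMaximalGKPSolution`,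
  `criticalBesovThreshold_eq_gkpCriticalThreshold`, `isCriticalElement_iff_isGKPCriticalElement`,
  `gkp_regularity_persistence_of_identification`, `gkp_exists_criticalElement_of_identification`,
  `gkp_criticalElement_tendsto_zero_of_identification`, `gkp_rigidity_of_identification`
  (each deprecated fact, resp. the statement `h3` of Prop. 2.3, = its faithful form over GKP's
  class + the identification hypothesis; for Prop. 2.3 also the equivalence under it,
  `gkp_rigidity_iff_of_identification`), and `not_isMaximalGKPSolution_of_biSup_lt_top` /
  `gkp_rigidity_pathSpace_of_blowup_pathSpace` (the faithful Prop. 2.3 is a corollary of Theorem 1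
  over GKP's class: `limsup ≤ sup`).

Also proved, and of independent use: `Literature.Analysis.FluidPDE.eLpNorm_count_exponent_antitone` (`ℓ^q ↪ ℓ^{q'}`,
`0 < q ≤ q'`, with constant one), `Literature.Analysis.FluidPDE.eHomBesovNorm_exponent_antitone` (`Ḃ^s_{p,q} ↪ Ḃ^s_{p,q'}`,
BCD Prop. 2.20, third index), `IsDistributionOf.congr_ae`, and the transfer of the solution
classes of `CriticalRegularity.lean` along a Besov embedding
(`IsBesovMildSolutionOn.of_norm_le`, `IsMaximalBesovMildSolution.of_critical_embedding`).

## GKP's solution class versus the tree's class; the deprecated facts (verdict clean-up, 2026-08-15)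

In print (arXiv:1407.4156, p. 4), `NS(u₀)` is *the unique solution of the Duhamel equation (1.2)
in the Chemin–Lerner path space* `X_T = 𝓛^{1:∞}_{p,q}(T) = L̃¹((0,T); Ḃ^{s_p+2}_{p,q}) ∩
L̃^∞((0,T); Ḃ^{s_p}_{p,q})` ((1.5); (1.6): "`u₁, u₂` satisfy (1.2) in `𝓛^{1:∞}_{p,q}(T)` ⟹
`u₁ = u₂ ∈ C([0,T]; Ḃ^{s_p}_{p,q}) ∩ C^∞(ℝ³ × (0,T])`"), `T*(u₀) = T*_{𝓛^{1:∞}_{p,q}(T)}(u₀)` is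
its maximal time in that class ((1.3)), and `A_c`, `𝒟_c`, Propositions 2.1–2.3 (§2.1, p. 6) and
their proofs (§2.3: "`u_n := NS(u_{0,n})`"; §2.4: "`A_n ≡ A_c`") are statements about `NS(u₀)`.
`CriticalRegularity.lean` renders `NS(u₀)` on `[0, T)`, `T ≤ T*`, by the class
`IsBesovMildSolutionOn` (duality-form mild identity from `t = 0`, `C([0,T); Ḃ^{s_p}_{p,q})`
through the distributions of the slices, Kato's class `K_∞`) and "`T = T*(u₀)`" by
`IsMaximalBesovMildSolution` (no extension *in that class*), under the standing assumption
(its §Design choices, "GKP's maximal time": "in which mild solutions are unique") that this class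
lies inside `𝓛^{1:∞}_{p,q}[T' < T]`. That identification is **not a published result** (audits:
`GKPRegularityPersistence.lean`, `GKPCriticalElementsPathSpace.lean`,
`GKPCompactnessPathSpace.lean`): continuity in the critical Besov space alone is not a
uniqueness class — for `3 < p ≤ ∞`, `1 ≤ q ≤ ∞` there are infinitely many mild solutions in
`C([0,T); Ḃ^{3/p-1}_{p,q}(ℝ³))` from the datum `0` (Fujii 2026, Thm. 1.2 (N2); his Rem. 1.3: no
contradiction with the class `C_t Ḃ ∩ L̃¹_t Ḃ^{s_p+2}`, i.e. `𝓛^{1:∞}`) — and the printed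
uniqueness theorems for Kato-type classes use an `L²`-in-time integrability at `t = 0` that
`K_∞` does not supply (Miura 2005, Thm. 2.3). Whether the tree's class is in fact a uniqueness
class is, as far as the sources go, open; nothing here asserts that the deprecated statements
are false (given Theorem 1 in the tree's rendering they even hold,
`GKPCriticalElementsProofs.lean`). Consequences drawn here:

* The tree-class renderings `gkp_regularity_persistence` ((1.9) with (1.6)),
  `gkp_exists_criticalElement` (Prop. 2.1), `gkp_criticalElement_tendsto_zero` (Prop. 2.2) and
  the former `gkp_rigidity` (Prop. 2.3, now the hypothesis `h3` of the assembly) are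
  **mis-stated**: each is the printed statement **plus** the
  identification (`gkp_regularity_persistence_of_identification`,
  `gkp_exists_criticalElement_of_identification`,
  `gkp_criticalElement_tendsto_zero_of_identification`, `gkp_rigidity_of_identification` below;
  in unfolded form already `gkp_regularity_persistence_of_pathSpace`,
  `gkp_exists_criticalElement_of_pathSpace`, `gkp_criticalElement_tendsto_zero_of_pathSpace`,
  `gkp_rigidity_of_pathSpace` of the audit files), and without it neither implication between
  the vendored and the printed statement is available (for a member of the tree's class that is
  not `NS(u 0)` nothing in §§2.3–2.5 relates its lifespan, its bound or its behaviour at the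
  blow-up time to the profiles of its datum or to the positive regularity of Prop. 2.8, the two
  thresholds `A_c` — hence the two sets `𝒟_c` — are defined over a priori different classes, and
  an extension in the tree's class is not an extension in `𝓛^{1:∞}_p`). The first three are
  **deprecated** (2026-08-15; verdicts of their prove seats, re-verified against pp. 4, 6, 8;
  Prop. 2.2 by its own prove seat, against §2.1 p. 6 and §2.4 pp. 8–9) and kept verbatim,
  statements unchanged, because the conditional reductions of this file family take them as
  hypotheses (`limsup_eq_top_of_isGKPExponent`, `criticalBesovThreshold_eq_top`,
  `gkp_besov_blowup_of_criticalElements` below, `gkp_besov_blowup_of_gkp`,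
  `gkp_besov_blowup_iff_gkp`, `gkp_criticalElement_tendsto_zero_of_gkp_besov_blowup` of
  `GKPCriticalElementsProofs.lean`, `gkp_criticalElement_tendsto_zero_of_pathSpace` of
  `GKPCompactnessPathSpace.lean`, `gkp_besov_blowup_of_pathSpace` of `GKPRigidityProofs.lean`,
  `NSCriticalClosureBesov*.lean`); the deprecation linter is silenced on exactly those in-file
  users, with a comment.
* **Prop. 2.3: review of the decomposition (2026-08-15, D-0026).** The fourth rendering,
  `gkp_rigidity` (mis-stated in the same way; verdict of its prove seat against §2.1 p. 6 and
  §2.5 p. 9), was a *decomposition child* of `gkp_besov_blowup` and was **retired and merged back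
  into the proof obligation of that parent**: Prop. 2.3 is Step 3 of the printed proof *by
  contradiction* of Thm. 1, its own proof (§2.5) is a theory (Prop. 2.8 = the iteration of §§4–5
  in the path spaces; ε-regularity, backward uniqueness and unique continuation for `NS(u₀)`), and
  over one and the same class it is a **corollary of the parent** — `limsup ≤ sup`:
  `gkp_rigidity_of_gkp_besov_blowup` (`GKPCriticalElementsProofs.lean`, tree classes),
  `gkp_rigidity_pathSpace_of_blowup_pathSpace` (below, GKP's class). Its statement — Prop. 2.3 in
  the tree's rendering: *for `ν > 0` and GKP exponents `p`, a Besov mild solution `(u, U)` on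
  `[0, T)`, `0 < T`, of the class `(s_p, p, p)` with `sup_{[0,T)} ‖U t‖_{Ḃ^{s_p}_{p,p}} < ∞` and
  `U t → 0` in `𝓢'` (Mathlib's weak-* topology of `TemperedDistribution`) as `t → T⁻` is not
  maximal in the tree's class with lifespan `T`* — survives verbatim (the body of the former def)
  as the explicit hypothesis `h3` of `limsup_eq_top_of_isGKPExponent`,
  `criticalBesovThreshold_eq_top`, `gkp_besov_blowup_of_criticalElements` (and of
  `gkp_besov_blowup_of_gkp`, `GKPCriticalElementsProofs.lean`), and as the conclusion of
  `gkp_rigidity_of_identification` below, of `gkp_rigidity_of_gkp_besov_blowup` and of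
  `gkp_rigidity_of_pathSpace` (`GKPRigidityProofs.lean`). No named fact replaces it: the faithful
  Prop. 2.3 (next bullet) is itself a corollary of the faithful Thm. 1.
* **The faithful statements**, over GKP's class (this file; function-valued data and general
  viscosity as everywhere in the family, see the next bullets):
  `(1.9) with (1.6)`: for all `ν > 0`, `p, q, p', q' ∈ (3, ∞)`, `T > 0`,
  `IsGKPSolutionOn p' q' T ν u U → U 0 ∈ Ḃ^{s_p}_{p,q} → IsGKPSolutionOn p q T ν u U`;
  `Prop. 2.1`: for all `ν > 0` and GKP exponents `p`,
  `gkpCriticalThreshold ν p < ∞ → ∃ T u U, IsGKPCriticalElement ν p T u U`;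
  `Prop. 2.2`: for all `ν > 0`, GKP exponents `p` and all `T`, `u`, `U`,
  `IsGKPCriticalElement ν p T u U → Tendsto U (𝓝[<] T) (𝓝 0)`;
  `Prop. 2.3`: for all `ν > 0`, GKP exponents `p`, `T > 0` and all `u`, `U`,
  `IsGKPSolutionOn p p T ν u U → ⨆ t ∈ Ico 0 T, ‖U t‖_{Ḃ^{s_p}_{p,p}} < ∞ →
  Tendsto U (𝓝[<] T) (𝓝 0) → ¬ IsMaximalGKPSolution p p T ν u U`.
  They are, verbatim, the hypotheses `h` of `gkp_regularity_persistence_of_identification`,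
  `gkp_exists_criticalElement_of_identification`,
  `gkp_criticalElement_tendsto_zero_of_identification` and `gkp_rigidity_of_identification`, and
  they are the **wanted named facts** `gkp_regularity_persistence_pathSpace`,
  `gkp_exists_criticalElement_pathSpace`, `gkp_criticalElement_tendsto_zero_pathSpace`,
  `gkp_rigidity_pathSpace` (to be cited as GKP2016, (1.9) and (1.6), resp. GKP2016, Prop. 2.1,
  resp. GKP2016, Prop. 2.2, resp. GKP2016, Prop. 2.3) — not declared in this file by the verdict
  clean-up or by the prove seats, which may not add named facts (D-0026), and left to cite items.
  The faithful Prop. 2.3 is moreover a corollary of Theorem 1 over the same class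
  (`gkp_rigidity_pathSpace_of_blowup_pathSpace`: `limsup ≤ sup`), exactly as its tree rendering
  `h3` is a corollary of the vendored `gkp_besov_blowup` (`gkp_rigidity_of_gkp_besov_blowup`,
  `GKPCriticalElementsProofs.lean`); in the paper it is Step 3 of the proof of Theorem 1. A cite
  item vendoring the faithful Thm. 1 (`gkp_besov_blowup_pathSpace`) should therefore record
  Prop. 2.3 as its proved corollary rather than as a fourth fact.

## Faithfulness notes (read with the design choices of `CriticalRegularity.lean`)

* **Solutions are function-valued.** As everywhere in `CriticalRegularity.lean`, `NS(u₀)` is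
  rendered by classes of function-valued mild solutions `u : ℝ → ℝ³ → ℝ³` seen in
  `Ḃ^{s_p}_{p,q}` through their distributions `U t` (`IsDistributionOf`), and "`T*(u₀) < ∞`"
  reads "`(u, U)` is maximal with lifespan `0 < T < ∞`". GKP allow arbitrary distributional data
  `u₀ ∈ Ḃ^{s_p}_{p,p}`. The two versions of `A_c` (over GKP's class) agree: a datum `u₀` with
  `T*(u₀) < ∞` has the smooth ((1.6)) time translates `NS(u₀)(s)`, `0 < s < T*`, with
  `T*(NS(u₀)(s)) = T*(u₀) - s` and
  `sup_{[0,T*-s)} ‖NS(NS(u₀)(s))‖ = sup_{[s,T*)} ‖NS(u₀)‖ ≤ sup_{[0,T*)} ‖NS(u₀)‖` — exactly the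
  device of GKP §2.4 (p. 8, `u_{0,n} := u_c(s_n)`, "`A_n ≡ A_c`"), which also shows that time
  translates of critical elements are critical elements. Hence Prop. 2.1 yields a
  *function-valued* critical element, which is how its faithful form is stated; Props. 2.2–2.3
  are stated for function-valued solutions (specialisations).
* **Viscosity.** GKP take `ν = 1`; as for `gkp_besov_blowup` everything is stated for `ν > 0`
  (apply the printed statement to `w(s, y) = ν⁻¹ u(s/ν, y)`).
* **`A_c` over `[0, ∞]`.** GKP's admissible bounds are reals `A > 0`; here `A : ℝ≥0∞`. The
  supremum is the same element of `[0, ∞]` (adding `A = 0` does not change a supremum of positive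
  reals, and `A = ∞` is admissible iff no solution blows up, in which case both suprema are `∞`);
  `criticalBesovThreshold_eq_iInf` / `gkpCriticalThreshold_eq_iInf` hold unconditionally in
  `[0, ∞]`.
* **Prop. 2.3** is printed as "`sup < ∞` and `NS(u₀)(t) → 0` in `𝓢'` as `t ↗ T*` imply
  `T* = ∞`"; for a solution on `[0, T)`, `T < ∞`, this says that `T` is not the maximal time,
  which is the form `¬ IsMaximalBesovMildSolution … T …` of the hypothesis `h3` below (resp.
  `¬ IsMaximalGKPSolution … T …` in the faithful form). Convergence in `𝓢'` is Mathlib's (weak-*)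
  topology of `TemperedDistribution`.
* **(1.9).** GKP: "`T*(u₀)` is independent of `p` and `q` for any `p, q ∈ (3, ∞)`" (for `u₀` in
  both spaces, by the embeddings (1.5) and propagation of regularity, Gallagher–Iftimie–Planchon
  2003), and by (1.6) `NS(u₀) ∈ C([0,T]; Ḃ^{s_p}_{p,q}) ∩ 𝓛^{1:∞}_{p,q}(T)` for `T < T*`. Faithful
  rendering: a GKP solution in the class `(p', q')` on `[0, T)` (hence `NS(u₀)` there, by the
  uniqueness (1.6)) whose initial distribution lies in `Ḃ^{s_p}_{p,q}` is a GKP solution in the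
  class `(p, q)` on `[0, T)`. The deprecated `gkp_regularity_persistence` says this for the
  tree's class on both sides.
* **Equation numbers** follow the CMP version; in the arXiv version (the held copy) the path
  spaces are (1.6), the uniqueness display is (1.7) and the exponent-independence of `T*` is
  (1.10).

## References

* I. Gallagher, G. S. Koch, F. Planchon, *Blow-up of critical Besov norms at a potential
  Navier–Stokes singularity*, Comm. Math. Phys. 343 (2016) 39–82 (arXiv:1407.4156): p. 4 ((1.2),
  (1.3), (1.5), (1.6), (1.9)), Rem. 1.3, (1.1), Thm. 1, §2.1 p. 6 (definitions of `A_c`, `𝒟_c`;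
  Props. 2.1, 2.2, 2.3), §2.3 and §2.4 p. 8, §2.5 p. 9 (Prop. 2.8 and the proof of Prop. 2.3).
* M. Fujii, *Sharp non-uniqueness for the Navier–Stokes equations in scaling critical spaces*,
  arXiv:2602.19846 (2026), Thm. 1.2, Rem. 1.3. [cite: Fujii2026, Thm. 1.2]
* H. Miura, *Remark on uniqueness of mild solutions to the Navier–Stokes equations*, J. Funct.
  Anal. 218 (2005) 110–129, Thm. 2.3. [cite: Miura2005, Thm. 2.3]
* I. Gallagher, D. Iftimie, F. Planchon, *Asymptotics and stability for global solutions to the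
  Navier–Stokes equations*, Ann. Inst. Fourier 53 (2003) 1387–1424 (propagation of regularity).
* H. Bahouri, J.-Y. Chemin, R. Danchin, *Fourier Analysis and Nonlinear PDE* (2011), Def. 2.15,
  Prop. 2.20 ("BCD").
-/

noncomputable section

open MeasureTheory TemperedDistribution Set Function Filter Topology
open scoped SchwartzMap ENNReal NNReal

namespace Literature.Analysis.FluidPDE

/-! ## Monotonicity of `ℓ^q` norms and of the Besov norm in the third index -/

section ThirdIndex

/-- **`ℓ^q ↪ ℓ^{q'}` with constant one**: for the counting measure and `0 < q ≤ q'`,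
`‖a‖_{ℓ^{q'}} ≤ ‖a‖_{ℓ^q}` (each term is bounded by the `ℓ^q` norm, so
`∑ aᵢ^{q'} ≤ ‖a‖_{ℓ^q}^{q'-q} ∑ aᵢ^q`; BCD Prop. 2.20, the third-index embedding). [folklore] -/
theorem eLpNorm_count_exponent_antitone {ι : Type*} [MeasurableSpace ι]
    [MeasurableSingletonClass ι] (a : ι → ℝ≥0∞) {q q' : ℝ≥0∞} (hq : q ≠ 0) (hqq' : q ≤ q') :
    eLpNorm a q' Measure.count ≤ eLpNorm a q Measure.count := by
  set N := eLpNorm a q Measure.count with hN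
  have hptw : ∀ i, a i ≤ N := fun i => by
    simpa only [enorm_eq_self] using enorm_le_eLpNorm_count a i hq
  rcases eq_or_ne q' ∞ with rfl | hq'top
  · rw [eLpNorm_exponent_top, eLpNormEssSup_count]
    exact iSup_le fun i => by simpa only [enorm_eq_self] using hptw i
  have hq'0 : q' ≠ 0 := ((pos_iff_ne_zero.2 hq).trans_le hqq').ne'
  have hqtop : q ≠ ∞ := ne_top_of_le_ne_top hq'top hqq'
  rcases eq_or_ne N ∞ with hNtop | hNtop
  · rw [hNtop]
    exact le_top
  have hq'pos : 0 < q'.toReal := ENNReal.toReal_pos hq'0 hq'top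
  have hqpos : 0 < q.toReal := ENNReal.toReal_pos hq hqtop
  have hd : 0 ≤ q'.toReal - q.toReal := sub_nonneg.2 (ENNReal.toReal_mono hq'top hqq')
  have hNq : ∫⁻ i, ‖a i‖ₑ ^ q.toReal ∂Measure.count = N ^ q.toReal := by
    rw [hN, eLpNorm_eq_lintegral_rpow_enorm_toReal hq hqtop, ← ENNReal.rpow_mul,
      one_div_mul_cancel hqpos.ne', ENNReal.rpow_one]
  have hsplit : q'.toReal = q.toReal + (q'.toReal - q.toReal) := by ring
  have hbound : ∫⁻ i, ‖a i‖ₑ ^ q'.toReal ∂Measure.count ≤ N ^ q'.toReal := by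
    calc ∫⁻ i, ‖a i‖ₑ ^ q'.toReal ∂Measure.count
        = ∫⁻ i, ‖a i‖ₑ ^ q.toReal * ‖a i‖ₑ ^ (q'.toReal - q.toReal) ∂Measure.count := by
          refine lintegral_congr fun i => ?_
          rw [← ENNReal.rpow_add_of_nonneg _ _ hqpos.le hd, ← hsplit]
      _ ≤ ∫⁻ i, ‖a i‖ₑ ^ q.toReal * N ^ (q'.toReal - q.toReal) ∂Measure.count := by
          refine lintegral_mono fun i => ?_
          have hi : ‖a i‖ₑ ≤ N := by simpa only [enorm_eq_self] using hptw i
          gcongr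
      _ = N ^ q.toReal * N ^ (q'.toReal - q.toReal) := by
          rw [lintegral_mul_const' _ _ (ENNReal.rpow_ne_top_of_nonneg hd hNtop), hNq]
      _ = N ^ q'.toReal := by
          rw [← ENNReal.rpow_add_of_nonneg _ _ hqpos.le hd, ← hsplit]
  calc eLpNorm a q' Measure.count
      = (∫⁻ i, ‖a i‖ₑ ^ q'.toReal ∂Measure.count) ^ (1 / q'.toReal) :=
        eLpNorm_eq_lintegral_rpow_enorm_toReal hq'0 hq'top
    _ ≤ (N ^ q'.toReal) ^ (1 / q'.toReal) := by gcongr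
    _ = N := by rw [← ENNReal.rpow_mul, mul_one_div_cancel hq'pos.ne', ENNReal.rpow_one]

variable {E F : Type*} [NormedAddCommGroup E] [InnerProductSpace ℝ E] [FiniteDimensional ℝ E]
  [MeasurableSpace E] [BorelSpace E] [NormedAddCommGroup F] [NormedSpace ℂ F] [CompleteSpace F]

/-- **The Besov norm is antitone in the third index**: `‖u‖_{Ḃ^s_{p,q'}} ≤ ‖u‖_{Ḃ^s_{p,q}}` for
`0 < q ≤ q'` (`ℓ^q(ℤ) ↪ ℓ^{q'}(ℤ)` with constant one; BCD Prop. 2.20, embedding in the third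
index; GKP 2016, (1.1)). [folklore] -/
theorem eHomBesovNorm_exponent_antitone (s : ℝ) (p : ℝ≥0∞) [Fact (1 ≤ p)] {q q' : ℝ≥0∞}
    (hq : q ≠ 0) (hqq' : q ≤ q') (u : 𝓢'(E, F)) :
    FunctionSpaces.eHomBesovNorm s p q' u ≤ FunctionSpaces.eHomBesovNorm s p q u :=
  eLpNorm_count_exponent_antitone _ hq hqq'

/-- `Ḃ^s_{p,q} ⊂ Ḃ^s_{p,q'}` for `0 < q ≤ q'` at the level of the classes `MemHomBesov` (the
realisation condition does not see `q`; BCD Prop. 2.20). [folklore] -/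
theorem _root_.Literature.Analysis.FunctionSpaces.MemHomBesov.of_exponent_le_third {s : ℝ} {p q q' : ℝ≥0∞} [Fact (1 ≤ p)] {u : 𝓢'(E, F)}
    (h : FunctionSpaces.MemHomBesov s p q u) (hq : q ≠ 0) (hqq' : q ≤ q') : FunctionSpaces.MemHomBesov s p q' u :=
  ⟨(eHomBesovNorm_exponent_antitone s p hq hqq' u).trans_lt h.1, h.2⟩

end ThirdIndex

section NS

/-! ## Distributions of a.e.-equal fields; transfer of the solution classes along embeddings -/

section Transfer

/-- A.e.-equal fields have the same tempered distribution: `IsDistributionOf` only sees the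
integrals `∫ φ • u₀` (BCD §1.2). [folklore] -/
theorem IsDistributionOf.congr_ae {ι : Type*} [Fintype ι] {E : Type*} [NormedAddCommGroup E]
    [NormedSpace ℝ E] [MeasureSpace E] {u₀ v₀ : E → EuclideanSpace ℝ ι}
    {U : 𝓢'(E, EuclideanSpace ℂ ι)} (hU : IsDistributionOf u₀ U) (h : u₀ =ᵐ[volume] v₀) :
    IsDistributionOf v₀ U := by
  intro φ
  have hφ : (fun x => φ x • FunctionSpaces.EuclideanSpace.complexify (u₀ x)) =ᵐ[volume]
      fun x => φ x • FunctionSpaces.EuclideanSpace.complexify (v₀ x) :=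
    h.mono fun x hx => by simp only [hx]
  exact ⟨(hU φ).1.congr hφ, (hU φ).2.trans (integral_congr_ae hφ)⟩

variable {ι : Type*} [Fintype ι]

/-- Continuity in `Ḃ^s_{p,q}` transfers along a continuous embedding
`‖·‖_{Ḃ^{s'}_{p',q'}} ≤ C ‖·‖_{Ḃ^s_{p,q}}` (GKP 2016, (1.1) and §2.1: the solution is continuous
with values in every larger critical space). [folklore] -/
theorem ContinuousInHomBesovOn.of_norm_le {S : Set ℝ} {s s' : ℝ} {p p' q q' : ℝ≥0∞}
    [Fact (1 ≤ p)] [Fact (1 ≤ p')] {C : ℝ≥0}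
    {U : ℝ → 𝓢'(EuclideanSpace ℝ ι, EuclideanSpace ℂ ι)}
    (hC : ∀ w : 𝓢'(EuclideanSpace ℝ ι, EuclideanSpace ℂ ι),
      FunctionSpaces.eHomBesovNorm s' p' q' w ≤ C * FunctionSpaces.eHomBesovNorm s p q w)
    (h : ContinuousInHomBesovOn S s p q U) : ContinuousInHomBesovOn S s' p' q' U := by
  refine ⟨fun t ht => ⟨(hC _).trans_lt (ENNReal.mul_lt_top ENNReal.coe_lt_top (h.1 t ht).1),
    (h.1 t ht).2⟩, fun t₀ ht₀ => ?_⟩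
  have h0 : Tendsto (fun t => (C : ℝ≥0∞) * FunctionSpaces.eHomBesovNorm s p q (U t - U t₀)) (𝓝[S] t₀) (𝓝 0) := by
    simpa only [mul_zero] using
      ENNReal.Tendsto.const_mul (h.2 t₀ ht₀) (Or.inr ENNReal.coe_ne_top)
  exact tendsto_of_tendsto_of_tendsto_of_le_of_le tendsto_const_nhds h0 (fun _ => zero_le)
    fun t => hC _

/-- The class of Besov mild solutions on `[0, T)` transfers along a continuous embedding
`‖·‖_{Ḃ^{s'}_{p',q'}} ≤ C ‖·‖_{Ḃ^s_{p,q}}` (only the continuity clause sees the Besov indices;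
GKP 2016, §2.1, first paragraph). [folklore] -/
theorem IsBesovMildSolutionOn.of_norm_le {s s' : ℝ} {p p' q q' : ℝ≥0∞} [Fact (1 ≤ p)]
    [Fact (1 ≤ p')] {T ν : ℝ} {u : ℝ → EuclideanSpace ℝ ι → EuclideanSpace ℝ ι}
    {U : ℝ → 𝓢'(EuclideanSpace ℝ ι, EuclideanSpace ℂ ι)} {C : ℝ≥0}
    (hC : ∀ w : 𝓢'(EuclideanSpace ℝ ι, EuclideanSpace ℂ ι),
      FunctionSpaces.eHomBesovNorm s' p' q' w ≤ C * FunctionSpaces.eHomBesovNorm s p q w)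
    (h : IsBesovMildSolutionOn s p q T ν u U) : IsBesovMildSolutionOn s' p' q' T ν u U where
  mild := h.mild
  aestronglyMeasurable := h.aestronglyMeasurable
  isDistributionOf := h.isDistributionOf
  continuousInHomBesovOn := h.continuousInHomBesovOn.of_norm_le hC
  memKatoClassOn := h.memKatoClassOn

/-- Along `g ≤ C f` with `C < ∞`, `limsup g = ∞` forces `limsup f = ∞` (used with the Besov
embedding to pull the blow-up back to the smaller critical space; GKP 2016, §2.1). [folklore] -/
theorem limsup_eq_top_of_le_const_mul {α : Type*} {l : Filter α} {C : ℝ≥0} {f g : α → ℝ≥0∞}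
    (hle : ∀ t, g t ≤ C * f t) (hg : limsup g l = ∞) : limsup f l = ∞ := by
  by_contra hf
  have h1 : limsup g l ≤ limsup (fun t => (C : ℝ≥0∞) * f t) l :=
    limsup_le_limsup (Eventually.of_forall hle)
  rw [ENNReal.limsup_const_mul_of_ne_top ENNReal.coe_ne_top, hg, top_le_iff] at h1
  exact ENNReal.mul_ne_top ENNReal.coe_ne_top hf h1

end Transfer

/-- Local notation for physical space `ℝ³ = EuclideanSpace ℝ (Fin 3)`. -/
local notation "ℝ³" => EuclideanSpace ℝ (Fin 3)

/-- Local notation for the complexified target `ℂ³ = EuclideanSpace ℂ (Fin 3)`. -/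
local notation "ℂ³" => EuclideanSpace ℂ (Fin 3)

/-! ## The critical embedding (1.1) on `ℝ³` -/

section Embedding

/-- **GKP (1.1)**, `Ḃ^{-1+3/p}_{p,q} ↪ Ḃ^{-1+3/p'}_{p',q'}` for `p ≤ p'`, `0 < q ≤ q'`: there is a
constant `C` with `‖w‖_{Ḃ^{-1+3/p'}_{p',q'}} ≤ C ‖w‖_{Ḃ^{-1+3/p}_{p,q}}` on `𝓢'(ℝ³, ℂ³)`, from the
Besov embedding `Literature.Analysis.FunctionSpaces.besov_embedding` (BCD Prop. 2.20, taken as the hypothesis `hE`; on `ℝ³`,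
`-1 + 3/p - 3(1/p - 1/p') = -1 + 3/p'`) and `eHomBesovNorm_exponent_antitone`.
[cite: GKP2016, (1.1)] -/
theorem exists_eHomBesovNorm_critical_le (hE : FunctionSpaces.besov_embedding (E := ℝ³) (F := ℂ³))
    {p p' q q' : ℝ≥0∞} [Fact (1 ≤ p)] [Fact (1 ≤ p')] (hpp' : p ≤ p') (hq : q ≠ 0)
    (hqq' : q ≤ q') :
    ∃ C : ℝ≥0, ∀ w : 𝓢'(ℝ³, ℂ³),
      FunctionSpaces.eHomBesovNorm (-1 + 3 / p'.toReal) p' q' w ≤ C * FunctionSpaces.eHomBesovNorm (-1 + 3 / p.toReal) p q w := by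
  obtain ⟨C, hC⟩ := hE (-1 + 3 / p.toReal) hpp' q
  refine ⟨C, fun w => ?_⟩
  have key : (-1 + 3 / p.toReal) - (Module.finrank ℝ ℝ³ : ℝ) * (p.toReal⁻¹ - p'.toReal⁻¹) =
      -1 + 3 / p'.toReal := by
    rw [finrank_euclideanSpace_fin]
    push_cast
    ring
  calc FunctionSpaces.eHomBesovNorm (-1 + 3 / p'.toReal) p' q' w
      ≤ FunctionSpaces.eHomBesovNorm (-1 + 3 / p'.toReal) p' q w := eHomBesovNorm_exponent_antitone _ _ hq hqq' w
    _ = FunctionSpaces.eHomBesovNorm ((-1 + 3 / p.toReal) -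
          (Module.finrank ℝ ℝ³ : ℝ) * (p.toReal⁻¹ - p'.toReal⁻¹)) p' q w := by rw [key]
    _ ≤ C * FunctionSpaces.eHomBesovNorm (-1 + 3 / p.toReal) p q w := hC w

end Embedding

/-! ## GKP exponents `p = 3·2^k - 2` -/

section Exponents

/-- **GKP exponents**: `p = 3·2^k - 2` for an integer `k ≥ 2` (`p ∈ {10, 22, 46, …}`), the
standing assumption of GKP 2016, §2 ("in the following we shall assume that `p = 3·2^k - 2`, for
a given integer `k ≥ 2`", §2.1; Prop. 2.8). Written additively, `p + 2 = 3·2^k`, to avoid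
truncated subtraction. [cite: GKP2016, §2.1] -/
def IsGKPExponent (p : ℝ≥0∞) : Prop :=
  ∃ k : ℕ, 2 ≤ k ∧ p + 2 = 3 * 2 ^ k

/-- `p = 10 = 3·2² - 2` is a GKP exponent. [cite: GKP2016, §2.1] -/
theorem isGKPExponent_ten : IsGKPExponent 10 :=
  ⟨2, le_rfl, by norm_num⟩

/-- GKP exponents are finite. [cite: GKP2016, §2.1] -/
theorem IsGKPExponent.lt_top {p : ℝ≥0∞} (hp : IsGKPExponent p) : p < ∞ := by
  obtain ⟨k, -, hpk⟩ := hp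
  calc p ≤ p + 2 := le_self_add
    _ = 3 * 2 ^ k := hpk
    _ < ∞ := ENNReal.mul_lt_top (by simp) (ENNReal.pow_lt_top (by simp))

/-- GKP exponents exceed `3` (indeed `p ≥ 10`). [cite: GKP2016, §2.1] -/
theorem IsGKPExponent.three_lt {p : ℝ≥0∞} (hp : IsGKPExponent p) : 3 < p := by
  obtain ⟨k, hk, hpk⟩ := hp
  have h12 : (12 : ℝ≥0∞) ≤ 3 * 2 ^ k :=
    calc (12 : ℝ≥0∞) = 3 * 2 ^ 2 := by norm_num
      _ ≤ 3 * 2 ^ k := by gcongr; exact one_le_two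
  by_contra h
  have h5 : p + 2 ≤ 5 :=
    calc p + 2 ≤ 3 + 2 := by gcongr; exact not_lt.1 h
      _ = 5 := by norm_num
  have : (12 : ℝ≥0∞) ≤ 5 := h12.trans (hpk ▸ h5)
  norm_num at this

/-- GKP exponents are `≥ 1` (the form consumed by `[Fact (1 ≤ p)]`). [cite: GKP2016, §2.1] -/
theorem IsGKPExponent.one_le {p : ℝ≥0∞} (hp : IsGKPExponent p) : 1 ≤ p :=
  le_trans (by norm_num) hp.three_lt.le

/-- **"One can choose `p` as large as needed"** (GKP 2016, §2.1): above any two finite exponents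
there is a GKP exponent `p' = 3·2^k - 2`. [cite: GKP2016, §2.1] -/
theorem exists_isGKPExponent_ge {p q : ℝ≥0∞} (hp : p < ∞) (hq : q < ∞) :
    ∃ p' : ℝ≥0∞, IsGKPExponent p' ∧ p ≤ p' ∧ q ≤ p' := by
  set n : ℕ := ⌈(max p q).toReal⌉₊ with hn
  set k : ℕ := max 2 n with hk
  have hpow : n < 2 ^ k := (le_max_right 2 n).trans_lt k.lt_two_pow_self
  have h1 : 1 ≤ 2 ^ k := Nat.one_le_two_pow
  refine ⟨((3 * 2 ^ k - 2 : ℕ) : ℝ≥0∞), ⟨k, le_max_left _ _, ?_⟩, ?_⟩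
  · have hnat : (3 * 2 ^ k - 2 : ℕ) + 2 = 3 * 2 ^ k := by omega
    exact_mod_cast hnat
  · have hge : n ≤ 3 * 2 ^ k - 2 := by omega
    have hmax : max p q ≤ ((3 * 2 ^ k - 2 : ℕ) : ℝ≥0∞) := by
      rw [← ENNReal.ofReal_toReal (max_lt hp hq).ne]
      calc ENNReal.ofReal (max p q).toReal ≤ ENNReal.ofReal n :=
            ENNReal.ofReal_le_ofReal (Nat.le_ceil _)
        _ = (n : ℝ≥0∞) := ENNReal.ofReal_natCast n
        _ ≤ ((3 * 2 ^ k - 2 : ℕ) : ℝ≥0∞) := by exact_mod_cast hge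
    exact ⟨(le_max_left _ _).trans hmax, (le_max_right _ _).trans hmax⟩

end Exponents

/-! ## `A_c` and the critical elements `𝒟_c` -/

section CriticalElements

/-- **Globality bounds** (GKP 2016, §2.1, the set inside the definition of `A_c`): `A` is a
globality bound (admissible) for `(ν, p)` when
"`sup_{t ∈ [0,T*(u₀))} ‖NS(u₀)(t)‖_{Ḃ^{s_p}_{p,p}} ≤ A ⟹ T*(u₀) = ∞` for all `u₀`", i.e.
(contrapositive) every maximal Besov mild solution of the class `(s_p, p, p)` with finite
lifespan `0 < T < ∞` has `sup_{[0,T)} ‖U t‖_{Ḃ^{s_p}_{p,p}} > A`.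
[cite: GKP2016, §2.1] -/
def IsGlobalityBound (ν : ℝ) (p : ℝ≥0∞) [Fact (1 ≤ p)] (A : ℝ≥0∞) : Prop :=
  ∀ ⦃T : ℝ⦄ ⦃u : ℝ → ℝ³ → ℝ³⦄ ⦃U : ℝ → 𝓢'(ℝ³, ℂ³)⦄, 0 < T →
    IsMaximalBesovMildSolution (-1 + 3 / p.toReal) p p T ν u U →
      A < ⨆ t ∈ Ico 0 T, FunctionSpaces.eHomBesovNorm (-1 + 3 / p.toReal) p p (U t)

/-- Admissibility is downward closed (GKP 2016, §2.1). [cite: GKP2016, §2.1] -/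
theorem IsGlobalityBound.mono {ν : ℝ} {p : ℝ≥0∞} [Fact (1 ≤ p)] {A B : ℝ≥0∞}
    (hB : IsGlobalityBound ν p B) (hAB : A ≤ B) : IsGlobalityBound ν p A :=
  fun _ _ _ hT hmax => hAB.trans_lt (hB hT hmax)

/-- **GKP's critical threshold**
`A_c := sup {A | sup_{[0,T*(u₀))} ‖NS(u₀)(t)‖_{Ḃ^{s_p}_{p,p}} ≤ A ⟹ T*(u₀) = ∞ for all u₀}`
(GKP 2016, §2.1), for viscosity `ν` and the class `(s_p, p, p)`, valued in `[0, ∞]`; Theorem 1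
for `p = q` says precisely `A_c = ∞`. [cite: GKP2016, §2.1] -/
def criticalBesovThreshold (ν : ℝ) (p : ℝ≥0∞) [Fact (1 ≤ p)] : ℝ≥0∞ :=
  sSup {A | IsGlobalityBound ν p A}

/-- Every maximal solution with finite lifespan has `sup_{[0,T)} ‖U t‖ ≥ A_c` (GKP 2016, §2.3,
(2.9): "`T*₁ < ∞`, hence by definition of `A_c` … `≥ A_c`"). [cite: GKP2016, §2.3] -/
theorem criticalBesovThreshold_le_biSup {ν : ℝ} {p : ℝ≥0∞} [Fact (1 ≤ p)] {T : ℝ}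
    {u : ℝ → ℝ³ → ℝ³} {U : ℝ → 𝓢'(ℝ³, ℂ³)} (hT : 0 < T)
    (hmax : IsMaximalBesovMildSolution (-1 + 3 / p.toReal) p p T ν u U) :
    criticalBesovThreshold ν p ≤ ⨆ t ∈ Ico 0 T, FunctionSpaces.eHomBesovNorm (-1 + 3 / p.toReal) p p (U t) :=
  sSup_le fun _ hA => (hA hT hmax).le

/-- Every `A < A_c` is admissible (GKP 2016, §2.1). [cite: GKP2016, §2.1] -/
theorem isGlobalityBound_of_lt {ν : ℝ} {p : ℝ≥0∞} [Fact (1 ≤ p)] {A : ℝ≥0∞}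
    (hA : A < criticalBesovThreshold ν p) : IsGlobalityBound ν p A := by
  obtain ⟨B, hB, hAB⟩ := lt_sSup_iff.1 hA
  exact IsGlobalityBound.mono hB hAB.le

/-- **GKP's second formula for `A_c`**: `A_c = inf {sup_{[0,T*(u₀))} ‖NS(u₀)(t)‖ | T*(u₀) < ∞}`
(GKP 2016, §2.1, "if `A_c` is finite, then …"; in `[0, ∞]` the identity holds unconditionally,
both sides being `∞` when no solution blows up). [cite: GKP2016, §2.1] -/
theorem criticalBesovThreshold_eq_iInf (ν : ℝ) (p : ℝ≥0∞) [Fact (1 ≤ p)] :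
    criticalBesovThreshold ν p =
      ⨅ (T : ℝ) (u : ℝ → ℝ³ → ℝ³) (U : ℝ → 𝓢'(ℝ³, ℂ³)) (_ : 0 < T)
        (_ : IsMaximalBesovMildSolution (-1 + 3 / p.toReal) p p T ν u U),
        ⨆ t ∈ Ico 0 T, FunctionSpaces.eHomBesovNorm (-1 + 3 / p.toReal) p p (U t) := by
  apply le_antisymm
  · exact le_iInf fun T => le_iInf fun u => le_iInf fun U => le_iInf fun hT =>
      le_iInf fun hmax => criticalBesovThreshold_le_biSup hT hmax
  · refine le_of_forall_lt_imp_le_of_dense fun A hA => le_sSup fun T u U hT hmax => ?_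
    exact hA.trans_le (iInf_le_of_le T <| iInf_le_of_le u <| iInf_le_of_le U <|
      iInf_le_of_le hT <| iInf_le_of_le hmax le_rfl)

/-- **Critical elements** (GKP 2016, §2.1, the set `𝒟_c`):
`𝒟_c := {u₀ | T*(u₀) < ∞ and sup_{t ∈ [0,T*(u₀))} ‖NS(u₀)(t)‖_{Ḃ^{s_p}_{p,p}} = A_c < ∞}`. In the
present vocabulary: `(u, U)` is a maximal Besov mild solution of the class `(s_p, p, p)` with
finite lifespan `0 < T < ∞`, whose critical norm has supremum exactly `A_c < ∞` on `[0, T)`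
(function-valued data; see the module docstring, §Faithfulness). [cite: GKP2016, §2.1] -/
structure IsCriticalElement (ν : ℝ) (p : ℝ≥0∞) [Fact (1 ≤ p)] (T : ℝ) (u : ℝ → ℝ³ → ℝ³)
    (U : ℝ → 𝓢'(ℝ³, ℂ³)) : Prop where
  /-- The lifespan is positive (and finite, being a real number): `T*(u₀) < ∞`. -/
  pos : 0 < T
  /-- `(u, U)` is `NS(u₀)` on its maximal interval `[0, T*)`, in the class `(s_p, p, p)`. -/
  isMaximal : IsMaximalBesovMildSolution (-1 + 3 / p.toReal) p p T ν u U
  /-- The critical norm has supremum exactly `A_c` on `[0, T*)`. -/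
  biSup_eq : ⨆ t ∈ Ico 0 T, FunctionSpaces.eHomBesovNorm (-1 + 3 / p.toReal) p p (U t) =
    criticalBesovThreshold ν p
  /-- `A_c < ∞`. -/
  threshold_lt_top : criticalBesovThreshold ν p < ∞

/-- A critical element has bounded critical norm on `[0, T*)` (its supremum is `A_c < ∞`;
GKP 2016, §2.1). [cite: GKP2016, §2.1] -/
theorem IsCriticalElement.biSup_lt_top {ν : ℝ} {p : ℝ≥0∞} [Fact (1 ≤ p)] {T : ℝ}
    {u : ℝ → ℝ³ → ℝ³} {U : ℝ → 𝓢'(ℝ³, ℂ³)} (h : IsCriticalElement ν p T u U) :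
    ⨆ t ∈ Ico 0 T, FunctionSpaces.eHomBesovNorm (-1 + 3 / p.toReal) p p (U t) < ∞ :=
  h.biSup_eq.trans_lt h.threshold_lt_top

/-- If Theorem 1 holds in `sup` form for the class `(s_p, p, p)` (every maximal solution with
finite lifespan has unbounded critical norm), then every finite bound is admissible and
`A_c = ∞` (GKP 2016, §2.1: "in the case that `A_c < ∞` (i.e. Theorem 1 is false)").
[cite: GKP2016, §2.1] -/
theorem criticalBesovThreshold_eq_top_of_biSup_eq_top {ν : ℝ} {p : ℝ≥0∞} [Fact (1 ≤ p)]
    (h : ∀ ⦃T : ℝ⦄ ⦃u : ℝ → ℝ³ → ℝ³⦄ ⦃U : ℝ → 𝓢'(ℝ³, ℂ³)⦄, 0 < T →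
      IsMaximalBesovMildSolution (-1 + 3 / p.toReal) p p T ν u U →
        ⨆ t ∈ Ico 0 T, FunctionSpaces.eHomBesovNorm (-1 + 3 / p.toReal) p p (U t) = ∞) :
    criticalBesovThreshold ν p = ∞ :=
  eq_top_iff.2 <| le_of_forall_lt_imp_le_of_dense fun A hA =>
    le_sSup fun T u U hT hmax => by rw [h hT hmax]; exact hA

end CriticalElements

/-! ## GKP's own solution class: `NS(u₀)` on `[0, T)`, `T*(u₀)`, and `A_c`, `𝒟_c` over it (pp. 4, 6) -/

section GKPClass

/-- **GKP solutions on `[0, T)`** — Gallagher–Koch–Planchon's `NS(u₀)` restricted to `[0, T)`,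
`T ≤ T*(u₀)`, in their own class (GKP 2016, p. 4: `NS(u₀)` is "the unique solution" of the
Duhamel equation (1.2) in `X_T = 𝓛^{1:∞}_{p,q}(T)`; (1.6): two solutions of (1.2) in
`𝓛^{1:∞}_{p,q}(T)` coincide and lie in `C([0,T]; Ḃ^{s_p}_{p,q}) ∩ C^∞(ℝ³ × (0,T])`; Rem. 1.3 for
`𝓛[T' < T]`): a Besov mild solution of the critical class `(s_p, p, q)` on `[0, T)` (the tree's
`IsBesovMildSolutionOn`: duality-form mild identity from `t = 0`, `U t` the distribution of the
slice `u t`, `U ∈ C([0,T); Ḃ^{s_p}_{p,q})`, Kato's class `K_∞`) **lying in the path space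
`𝓛^{1:∞}_{p,q}[T' < T]`**, i.e. `‖U‖_{𝓛^{1:∞}_{p,q}(0,T')} < ∞` for every `0 < T' < T`
(`Literature.Analysis.FunctionSpaces.eGKPPathNorm 1 ∞ p q 0 T'`). The second clause is literally
`MemGKPPathSpace p q T U` of `GKPRegularityPersistence.lean` (declared downstream of this file,
whence the unfolded form; `memGKPPathSpace_iff` there is `Iff.rfl`). [cite: GKP2016, (1.6)] -/
structure IsGKPSolutionOn (p q : ℝ≥0∞) [Fact (1 ≤ p)] (T ν : ℝ) (u : ℝ → ℝ³ → ℝ³)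
    (U : ℝ → 𝓢'(ℝ³, ℂ³)) : Prop where
  /-- `(u, U)` is a Besov mild solution of the critical class `(s_p, p, q)` on `[0, T)`. -/
  isBesovMildSolutionOn : IsBesovMildSolutionOn (-1 + 3 / p.toReal) p q T ν u U
  /-- `U ∈ 𝓛^{1:∞}_{p,q}[T' < T]`: finite path-space norm on every `(0, T')`, `0 < T' < T`. -/
  pathNorm_lt_top : ∀ T' ∈ Ioo 0 T, FunctionSpaces.eGKPPathNorm 1 ∞ p q 0 T' U < ∞

/-- Restriction of a GKP solution to a shorter interval `T' ≤ T` (GKP 2016, Rem. 1.3: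
`𝓛[T'' < T']` only asks finiteness on the shorter intervals). [cite: GKP2016, Rem. 1.3] -/
theorem IsGKPSolutionOn.mono {p q : ℝ≥0∞} [Fact (1 ≤ p)] {T T' ν : ℝ} {u : ℝ → ℝ³ → ℝ³}
    {U : ℝ → 𝓢'(ℝ³, ℂ³)} (h : IsGKPSolutionOn p q T ν u U) (hT : T' ≤ T) :
    IsGKPSolutionOn p q T' ν u U :=
  ⟨h.isBesovMildSolutionOn.mono hT, fun T'' hT'' => h.pathNorm_lt_top T'' ⟨hT''.1, hT''.2.trans_le hT⟩⟩

/-- **`T = T*(u₀)`** over GKP's class (GKP 2016, (1.3): `T*` is the maximal time of `NS(u₀)` in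
`𝓛^{1:∞}_{p,q}`): `(u, U)` is a GKP solution on `[0, T)` and no GKP solution `(v, V)` of the same
class on a longer interval `[0, T')`, `T' > T`, agrees with `u` a.e. at every time of `[0, T)`.
Twin of `IsMaximalBesovMildSolution` with the tree's class replaced by GKP's; meaningful for
`0 < T < ∞`. [cite: GKP2016, (1.3)] -/
structure IsMaximalGKPSolution (p q : ℝ≥0∞) [Fact (1 ≤ p)] (T ν : ℝ) (u : ℝ → ℝ³ → ℝ³)
    (U : ℝ → 𝓢'(ℝ³, ℂ³)) : Prop where
  /-- `(u, U)` is a GKP solution on `[0, T)`. -/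
  isGKPSolutionOn : IsGKPSolutionOn p q T ν u U
  /-- No GKP solution of the same class on a longer interval extends `u`. -/
  not_extendable : ¬ ∃ T' > T, ∃ (v : ℝ → ℝ³ → ℝ³) (V : ℝ → 𝓢'(ℝ³, ℂ³)),
      IsGKPSolutionOn p q T' ν v V ∧ ∀ t ∈ Ico 0 T, v t =ᵐ[volume] u t

/-- A GKP solution on a longer interval `[0, T')`, `T < T'`, is not maximal with lifespan `T` (it
extends its own restriction; GKP 2016, (1.3)). [cite: GKP2016, (1.3)] -/
theorem IsGKPSolutionOn.not_isMaximalGKPSolution {p q : ℝ≥0∞} [Fact (1 ≤ p)] {T T' ν : ℝ}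
    (hTT' : T < T') {u : ℝ → ℝ³ → ℝ³} {U : ℝ → 𝓢'(ℝ³, ℂ³)} (h : IsGKPSolutionOn p q T' ν u U) :
    ¬ IsMaximalGKPSolution p q T ν u U :=
  fun hmax => hmax.not_extendable ⟨T', hTT', u, U, h, fun _ _ => ae_eq_refl _⟩

/-- A maximal Besov mild solution of the critical class (no extension in the tree's class) has in
particular no extension in GKP's class, since a GKP solution is a Besov mild solution
(GKP 2016, (1.3)). [cite: GKP2016, (1.3)] -/
theorem IsMaximalBesovMildSolution.not_exists_gkp_extension {p q : ℝ≥0∞} [Fact (1 ≤ p)]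
    {T ν : ℝ} {u : ℝ → ℝ³ → ℝ³} {U : ℝ → 𝓢'(ℝ³, ℂ³)}
    (hmax : IsMaximalBesovMildSolution (-1 + 3 / p.toReal) p q T ν u U) :
    ¬ ∃ T' > T, ∃ (v : ℝ → ℝ³ → ℝ³) (V : ℝ → 𝓢'(ℝ³, ℂ³)),
      IsGKPSolutionOn p q T' ν v V ∧ ∀ t ∈ Ico 0 T, v t =ᵐ[volume] u t :=
  fun ⟨T', hT', v, V, hv, hvu⟩ => hmax.not_extendable ⟨T', hT', v, V, hv.isBesovMildSolutionOn, hvu⟩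

/-- **Globality bounds over GKP's class** (GKP 2016, §2.1, the set inside the definition of
`A_c`, verbatim: "`sup_{t ∈ [0,T*(u₀))} ‖NS(u₀)(t)‖_{Ḃ^{s_p}_{p,p}} ≤ A ⟹ T*(u₀) = ∞` for all
`u₀`"), contrapositive: every maximal GKP solution of the class `(s_p, p, p)` with finite
lifespan `0 < T < ∞` has `sup_{[0,T)} ‖U t‖_{Ḃ^{s_p}_{p,p}} > A`. Twin of `IsGlobalityBound`.
[cite: GKP2016, §2.1] -/
def IsGKPGlobalityBound (ν : ℝ) (p : ℝ≥0∞) [Fact (1 ≤ p)] (A : ℝ≥0∞) : Prop :=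
  ∀ ⦃T : ℝ⦄ ⦃u : ℝ → ℝ³ → ℝ³⦄ ⦃U : ℝ → 𝓢'(ℝ³, ℂ³)⦄, 0 < T → IsMaximalGKPSolution p p T ν u U →
    A < ⨆ t ∈ Ico 0 T, FunctionSpaces.eHomBesovNorm (-1 + 3 / p.toReal) p p (U t)

/-- Admissibility over GKP's class is downward closed (GKP 2016, §2.1). [cite: GKP2016, §2.1] -/
theorem IsGKPGlobalityBound.mono {ν : ℝ} {p : ℝ≥0∞} [Fact (1 ≤ p)] {A B : ℝ≥0∞}
    (hB : IsGKPGlobalityBound ν p B) (hAB : A ≤ B) : IsGKPGlobalityBound ν p A :=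
  fun _ _ _ hT hmax => hAB.trans_lt (hB hT hmax)

/-- **GKP's critical threshold `A_c`, as printed** (GKP 2016, §2.1):
`A_c := sup {A | sup_{[0,T*(u₀))} ‖NS(u₀)(t)‖_{Ḃ^{s_p}_{p,p}} ≤ A ⟹ T*(u₀) = ∞ for all u₀}` with
`NS(u₀)`, `T*(u₀)` read in GKP's class `𝓛^{1:∞}_p[T' < T*]` (`IsMaximalGKPSolution`), for
viscosity `ν`, valued in `[0, ∞]`; Theorem 1 for `p = q` says precisely `A_c = ∞`. Twin of
`criticalBesovThreshold` (the same supremum over the tree's class); the two agree under the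
identification of the classes (`criticalBesovThreshold_eq_gkpCriticalThreshold`).
[cite: GKP2016, §2.1] -/
def gkpCriticalThreshold (ν : ℝ) (p : ℝ≥0∞) [Fact (1 ≤ p)] : ℝ≥0∞ :=
  sSup {A | IsGKPGlobalityBound ν p A}

/-- Every maximal GKP solution with finite lifespan has `sup_{[0,T)} ‖U t‖ ≥ A_c` (GKP 2016,
§2.3, (2.9): "`T*₁ < ∞`, hence by definition of `A_c` … `≥ A_c`"). [cite: GKP2016, §2.3] -/
theorem gkpCriticalThreshold_le_biSup {ν : ℝ} {p : ℝ≥0∞} [Fact (1 ≤ p)] {T : ℝ}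
    {u : ℝ → ℝ³ → ℝ³} {U : ℝ → 𝓢'(ℝ³, ℂ³)} (hT : 0 < T) (hmax : IsMaximalGKPSolution p p T ν u U) :
    gkpCriticalThreshold ν p ≤ ⨆ t ∈ Ico 0 T, FunctionSpaces.eHomBesovNorm (-1 + 3 / p.toReal) p p (U t) :=
  sSup_le fun _ hA => (hA hT hmax).le

/-- Every `A < A_c` is admissible over GKP's class (GKP 2016, §2.1). [cite: GKP2016, §2.1] -/
theorem isGKPGlobalityBound_of_lt {ν : ℝ} {p : ℝ≥0∞} [Fact (1 ≤ p)] {A : ℝ≥0∞}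
    (hA : A < gkpCriticalThreshold ν p) : IsGKPGlobalityBound ν p A := by
  obtain ⟨B, hB, hAB⟩ := lt_sSup_iff.1 hA
  exact IsGKPGlobalityBound.mono hB hAB.le

/-- **GKP's second formula for `A_c`, as printed**:
`A_c = inf {sup_{[0,T*(u₀))} ‖NS(u₀)(t)‖ | T*(u₀) < ∞}` over GKP's class (GKP 2016, §2.1, "if
`A_c` is finite, then …"; in `[0, ∞]` the identity holds unconditionally, both sides being `∞`
when no GKP solution blows up). [cite: GKP2016, §2.1] -/
theorem gkpCriticalThreshold_eq_iInf (ν : ℝ) (p : ℝ≥0∞) [Fact (1 ≤ p)] :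
    gkpCriticalThreshold ν p =
      ⨅ (T : ℝ) (u : ℝ → ℝ³ → ℝ³) (U : ℝ → 𝓢'(ℝ³, ℂ³)) (_ : 0 < T)
        (_ : IsMaximalGKPSolution p p T ν u U),
        ⨆ t ∈ Ico 0 T, FunctionSpaces.eHomBesovNorm (-1 + 3 / p.toReal) p p (U t) := by
  apply le_antisymm
  · exact le_iInf fun T => le_iInf fun u => le_iInf fun U => le_iInf fun hT =>
      le_iInf fun hmax => gkpCriticalThreshold_le_biSup hT hmax
  · refine le_of_forall_lt_imp_le_of_dense fun A hA => le_sSup fun T u U hT hmax => ?_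
    exact hA.trans_le (iInf_le_of_le T <| iInf_le_of_le u <| iInf_le_of_le U <|
      iInf_le_of_le hT <| iInf_le_of_le hmax le_rfl)

/-- **Critical elements over GKP's class, as printed** (GKP 2016, §2.1, the set `𝒟_c`):
`𝒟_c := {u₀ | T*(u₀) < ∞ and sup_{t ∈ [0,T*(u₀))} ‖NS(u₀)(t)‖_{Ḃ^{s_p}_{p,p}} = A_c < ∞}` with
`NS(u₀)`, `T*(u₀)`, `A_c` read in GKP's class: `(u, U)` is a maximal GKP solution of the class
`(s_p, p, p)` with finite lifespan `0 < T < ∞` whose critical norm has supremum exactly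
`A_c = gkpCriticalThreshold ν p < ∞` on `[0, T)` (function-valued data: by §2.4, p. 8, the time
translates `u_c(s) = NS(u_{0,c})(s)`, `0 < s < T*`, of a critical element are critical elements,
"`A_n ≡ A_c`", and they are smooth by (1.6)). Twin of `IsCriticalElement`.
[cite: GKP2016, §2.1] -/
structure IsGKPCriticalElement (ν : ℝ) (p : ℝ≥0∞) [Fact (1 ≤ p)] (T : ℝ) (u : ℝ → ℝ³ → ℝ³)
    (U : ℝ → 𝓢'(ℝ³, ℂ³)) : Prop where
  /-- The lifespan is positive (and finite, being a real number): `T*(u₀) < ∞`. -/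
  pos : 0 < T
  /-- `(u, U)` is `NS(u₀)` on its maximal interval `[0, T*)`, in the class `𝓛^{1:∞}_p[T < T*]`. -/
  isMaximal : IsMaximalGKPSolution p p T ν u U
  /-- The critical norm has supremum exactly `A_c` on `[0, T*)`. -/
  biSup_eq : ⨆ t ∈ Ico 0 T, FunctionSpaces.eHomBesovNorm (-1 + 3 / p.toReal) p p (U t) =
    gkpCriticalThreshold ν p
  /-- `A_c < ∞`. -/
  threshold_lt_top : gkpCriticalThreshold ν p < ∞

/-- A GKP critical element has bounded critical norm on `[0, T*)` (its supremum is `A_c < ∞`;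
GKP 2016, §2.1). [cite: GKP2016, §2.1] -/
theorem IsGKPCriticalElement.biSup_lt_top {ν : ℝ} {p : ℝ≥0∞} [Fact (1 ≤ p)] {T : ℝ}
    {u : ℝ → ℝ³ → ℝ³} {U : ℝ → 𝓢'(ℝ³, ℂ³)} (h : IsGKPCriticalElement ν p T u U) :
    ⨆ t ∈ Ico 0 T, FunctionSpaces.eHomBesovNorm (-1 + 3 / p.toReal) p p (U t) < ∞ :=
  h.biSup_eq.trans_lt h.threshold_lt_top

/-- **Membership in `𝒟_c` needs only `sup ≤ A_c`** (GKP 2016, §2.3, closing step of the proof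
of Prop. 2.1: for a solution with `T* < ∞`, "by definition of `A_c`" the supremum is `≥ A_c`,
`gkpCriticalThreshold_le_biSup`, so `sup ≤ A_c < ∞` already gives `sup = A_c`).
[cite: GKP2016, §2.3] -/
theorem IsGKPCriticalElement.of_biSup_le {ν : ℝ} {p : ℝ≥0∞} [Fact (1 ≤ p)] {T : ℝ}
    {u : ℝ → ℝ³ → ℝ³} {U : ℝ → 𝓢'(ℝ³, ℂ³)} (hT : 0 < T) (hmax : IsMaximalGKPSolution p p T ν u U)
    (hle : ⨆ t ∈ Ico 0 T, FunctionSpaces.eHomBesovNorm (-1 + 3 / p.toReal) p p (U t) ≤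
      gkpCriticalThreshold ν p)
    (hA : gkpCriticalThreshold ν p < ∞) : IsGKPCriticalElement ν p T u U where
  pos := hT
  isMaximal := hmax
  biSup_eq := le_antisymm hle (gkpCriticalThreshold_le_biSup hT hmax)
  threshold_lt_top := hA

/-- If every maximal GKP solution with finite lifespan has unbounded critical norm (Theorem 1 in
`sup` form, read in GKP's class), then every finite bound is admissible and `A_c = ∞` (GKP 2016,
§2.1: "in the case that `A_c < ∞` (i.e. Theorem 1 is false)"). [cite: GKP2016, §2.1] -/
theorem gkpCriticalThreshold_eq_top_of_biSup_eq_top {ν : ℝ} {p : ℝ≥0∞} [Fact (1 ≤ p)]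
    (h : ∀ ⦃T : ℝ⦄ ⦃u : ℝ → ℝ³ → ℝ³⦄ ⦃U : ℝ → 𝓢'(ℝ³, ℂ³)⦄, 0 < T →
      IsMaximalGKPSolution p p T ν u U →
        ⨆ t ∈ Ico 0 T, FunctionSpaces.eHomBesovNorm (-1 + 3 / p.toReal) p p (U t) = ∞) :
    gkpCriticalThreshold ν p = ∞ :=
  eq_top_iff.2 <| le_of_forall_lt_imp_le_of_dense fun A hA =>
    le_sSup fun T u U hT hmax => by rw [h hT hmax]; exact hA

end GKPClass

/-! ## The named facts: (1.9) and Propositions 2.1, 2.2 (all deprecated); Proposition 2.3 retired -/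

section Facts

/-- **Deprecated (2026-08-15) — mis-stated** (verdict of its prove seat, re-verified here
against arXiv:1407.4156, p. 4; the statement is kept verbatim, unchanged, because the conditional
reductions `IsMaximalBesovMildSolution.of_critical_embedding`,
`gkp_besov_blowup_of_criticalElements` (below), `gkp_besov_blowup_of_gkp`,
`gkp_besov_blowup_iff_gkp` (`GKPCriticalElementsProofs.lean`) and `NSCriticalClosureBesov*.lean`
take it as a hypothesis). *Intended:* GKP (1.9) with (1.6), "`T*(u₀)` is independent of `p` and
`q` for any `p, q ∈ (3, ∞)`" (for `u₀` in both spaces) and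
`NS(u₀) ∈ C([0,T]; Ḃ^{s_p}_{p,q})` for `T < T*`. *What is wrong:* in print both statements concern
`NS(u₀)`, the unique solution of the Duhamel equation (1.2) in the Chemin–Lerner path space
`𝓛^{1:∞}_{p,q}[T' < T]` (p. 4, (1.3), (1.5), (1.6)), whereas this `Prop` quantifies, in hypothesis
**and** conclusion, over the tree's class `IsBesovMildSolutionOn` (duality-form mild,
`C([0,T); Ḃ^{s_p}_{p,q})`, Kato's class `K_∞`), which is not a published uniqueness class
(continuity in the critical Besov space alone is not one, Fujii 2026, Thm. 1.2 (N2); the printed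
uniqueness theorems for Kato-type classes need an `L²`-in-time integrability at `t = 0`,
Miura 2005, Thm. 2.3); the statement follows from its source only together with the unprinted
identification "every `IsBesovMildSolutionOn` solution lies in `𝓛^{1:∞}[T' < T]`" —
machine-checked: `gkp_regularity_persistence_of_identification` below
(= faithful form + identification; in unfolded form `gkp_regularity_persistence_of_pathSpace`,
`GKPRegularityPersistence.lean`). *The faithful statement* ((1.9) with (1.6) over GKP's class
`IsGKPSolutionOn`; wanted named fact `gkp_regularity_persistence_pathSpace`, hypothesis `h` of
`gkp_regularity_persistence_of_identification` verbatim):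
`∀ {ν}, 0 < ν → ∀ {p q p' q'} [Fact (1 ≤ p)] [Fact (1 ≤ p')], 3 < p → p < ∞ → 3 < q → q < ∞ →
3 < p' → p' < ∞ → 3 < q' → q' < ∞ → ∀ {T}, 0 < T → ∀ {u U}, IsGKPSolutionOn p' q' T ν u U →
MemHomBesov (-1 + 3/p) p q (U 0) → IsGKPSolutionOn p q T ν u U`.
*Original content (unchanged):* if `(u, U)` is a Besov mild solution on `[0, T)` in the class
`(s_{p'}, p', q')` and its initial distribution `U 0` lies in `Ḃ^{s_p}_{p,q}`, then `(u, U)` is a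
Besov mild solution on `[0, T)` in the class `(s_p, p, q)`, for all `p, q, p', q' ∈ (3, ∞)`,
`ν > 0`. [cite: GKP2016, (1.9) and (1.6)] -/
@[deprecated "mis-stated (2026-08-15): GKP (1.9)+(1.6) concern NS(u₀), the unique solution in the path space 𝓛^{1:∞}_{p,q}[T'<T], but this Prop quantifies over the tree's class IsBesovMildSolutionOn (not a published uniqueness class); it is the faithful statement + the unprinted identification of the classes (gkp_regularity_persistence_of_identification). Faithful form: hypothesis `h` of Literature.Analysis.FluidPDE.gkp_regularity_persistence_of_identification (over IsGKPSolutionOn), wanted as named fact gkp_regularity_persistence_pathSpace" (since := "2026-08-15")]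
def gkp_regularity_persistence : Prop :=
  ∀ {ν : ℝ}, 0 < ν → ∀ {p q p' q' : ℝ≥0∞} [Fact (1 ≤ p)] [Fact (1 ≤ p')], 3 < p → p < ∞ →
    3 < q → q < ∞ → 3 < p' → p' < ∞ → 3 < q' → q' < ∞ → ∀ {T : ℝ}, 0 < T →
    ∀ {u : ℝ → ℝ³ → ℝ³} {U : ℝ → 𝓢'(ℝ³, ℂ³)},
    IsBesovMildSolutionOn (-1 + 3 / p'.toReal) p' q' T ν u U →
    FunctionSpaces.MemHomBesov (-1 + 3 / p.toReal) p q (U 0) →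
    IsBesovMildSolutionOn (-1 + 3 / p.toReal) p q T ν u U

/-- **Deprecated (2026-08-15) — mis-stated** (verdict of its prove seat, re-verified here
against arXiv:1407.4156, pp. 4, 6, 8; the statement is kept verbatim, unchanged, because the
conditional reductions `limsup_eq_top_of_isGKPExponent`, `criticalBesovThreshold_eq_top`,
`gkp_besov_blowup_of_criticalElements` (below), `gkp_besov_blowup_of_gkp`,
`gkp_besov_blowup_iff_gkp`, `gkp_exists_criticalElement_of_gkp_besov_blowup`
(`GKPCriticalElementsProofs.lean`), `gkp_exists_criticalElement_of_pathSpace`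
(`GKPCriticalElementsPathSpace.lean`) and `NSCriticalClosureBesov*.lean` name it). *Intended:*
GKP Proposition 2.1 (existence of a critical element), "If `A_c < ∞`, then the set `𝒟_c` is non
empty" (§2.1, p. 6, under the standing assumption `p = q = 3·2^k - 2`, `k ≥ 2`; proved in §2.3
from the profile decomposition Thm. 3 and Prop. 2.6). *What is wrong:* in print `A_c` and `𝒟_c`
are defined through `NS(u₀)`, the unique solution of (1.2) in `𝓛^{1:∞}_p[T < T*]`, and its
maximal time `T*(u₀)` in that class (p. 4), and the proof runs through `u_n := NS(u_{0,n})`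
(§2.3, p. 8); this `Prop` instead takes both the hypothesis `A_c < ∞` (`criticalBesovThreshold`,
an infimum over **all** `IsMaximalBesovMildSolution` solutions of the tree's class: duality-form
mild, `C([0,T); Ḃ^{s_p}_{p,p})`, Kato's class `K_∞`, no extension *in that class*) and the
conclusion `𝒟_c ≠ ∅` (`IsCriticalElement`) over the tree's class, which is not a published
uniqueness class (Fujii 2026, Thm. 1.2 (N2); Miura 2005, Thm. 2.3), so that the two thresholds
are infima over a priori different classes and neither implication between this statement and
the printed one is available without the unprinted identification of the classes —
machine-checked: `gkp_exists_criticalElement_of_identification` below (= faithful form +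
identification; in unfolded form `gkp_exists_criticalElement_of_pathSpace`,
`GKPCriticalElementsPathSpace.lean`). *The faithful statement* (Prop. 2.1 over GKP's class, with
`A_c = gkpCriticalThreshold` and `𝒟_c = IsGKPCriticalElement`; wanted named fact
`gkp_exists_criticalElement_pathSpace`, hypothesis `h` of
`gkp_exists_criticalElement_of_identification` verbatim):
`∀ {ν}, 0 < ν → ∀ {p} [Fact (1 ≤ p)], IsGKPExponent p → gkpCriticalThreshold ν p < ∞ →
∃ T u U, IsGKPCriticalElement ν p T u U`.
*Original content (unchanged):* for `ν > 0` and a GKP exponent `p`, if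
`criticalBesovThreshold ν p < ∞` then there is a critical element of the tree's class
(`IsCriticalElement ν p T u U`: a maximal Besov mild solution with finite lifespan and
`sup_{[0,T)} ‖U t‖_{Ḃ^{s_p}_{p,p}} = A_c`; function-valued data by the device of §2.4, general
viscosity as in `gkp_besov_blowup`). [cite: GKP2016, Prop. 2.1 (with §2.4 and (1.6))] -/
@[deprecated "mis-stated (2026-08-15): GKP Prop. 2.1 concerns A_c and 𝒟_c defined through NS(u₀) in the path space 𝓛^{1:∞}_p[T<T*], but this Prop reads hypothesis (criticalBesovThreshold) and conclusion (IsCriticalElement) over the tree's class IsMaximalBesovMildSolution (not a published uniqueness class); it is the faithful statement + the unprinted identification of the classes (gkp_exists_criticalElement_of_identification). Faithful form: hypothesis `h` of Literature.Analysis.FluidPDE.gkp_exists_criticalElement_of_identification (gkpCriticalThreshold ν p < ∞ → ∃ T u U, IsGKPCriticalElement ν p T u U), wanted as named fact gkp_exists_criticalElement_pathSpace" (since := "2026-08-15")]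
def gkp_exists_criticalElement : Prop :=
  ∀ {ν : ℝ}, 0 < ν → ∀ {p : ℝ≥0∞} [Fact (1 ≤ p)], IsGKPExponent p →
    criticalBesovThreshold ν p < ∞ →
    ∃ (T : ℝ) (u : ℝ → ℝ³ → ℝ³) (U : ℝ → 𝓢'(ℝ³, ℂ³)), IsCriticalElement ν p T u U

/-- **Deprecated (2026-08-15) — mis-stated** (verdict of its prove seat, verified against
arXiv:1407.4156, §2.1 p. 6 and §2.4 pp. 8–9; the statement is kept verbatim, unchanged, because
the conditional reductions `limsup_eq_top_of_isGKPExponent`, `criticalBesovThreshold_eq_top`,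
`gkp_besov_blowup_of_criticalElements` (this file), `gkp_criticalElement_tendsto_zero_of_gkp_besov_blowup`,
`gkp_besov_blowup_of_gkp`, `gkp_besov_blowup_iff_gkp` (`GKPCriticalElementsProofs.lean`),
`gkp_criticalElement_tendsto_zero_of_pathSpace` (`GKPCompactnessPathSpace.lean`),
`gkp_besov_blowup_of_pathSpace` (`GKPRigidityProofs.lean`) and `NSCriticalClosureBesov*.lean`
name it). *Intended:* GKP Proposition 2.2 (compactness at blow-up time of critical elements),
"If `A_c < ∞`, then any `u₀` in `𝒟_c` satisfies `NS(u₀)(t) → 0` in `𝓢'` as `t ↗ T*(u₀)`"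
(§2.1, p. 6, under the standing assumption `p = q = 3·2^k - 2`, `k ≥ 2`; proved in §2.4 from
the profile decomposition Thm. 3, Prop. 2.6 and the orthogonality (2.12)). *What is wrong:* in
print `𝒟_c` is defined through `NS(u₀)`, the unique solution of (1.2) in `𝓛^{1:∞}_p[T < T*]`,
its maximal time `T*(u₀)` in that class and the threshold `A_c` over that class (pp. 4, 6), and
the proof runs through `u_{0,n} := u_c(s_n)`, `NS(u_{0,n})(t) = u_c(s_n + t)`, `A_n ≡ A_c`
(§2.4, p. 8); this `Prop` instead takes its hypothesis `u₀ ∈ 𝒟_c` (`IsCriticalElement`: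
maximal in the tree's class `IsMaximalBesovMildSolution` — duality-form mild,
`C([0,T); Ḃ^{s_p}_{p,p})`, Kato's class `K_∞`, no extension *in that class* — with supremum
equal to `criticalBesovThreshold`, an infimum over **all** such solutions) over the tree's class,
which is not a published uniqueness class (Fujii 2026, Thm. 1.2 (N2); Miura 2005, Thm. 2.3), so
that a critical element in this sense need neither be `NS(u 0)` on `[0, T)` nor attain the
printed `A_c`, and neither implication between this statement and the printed one is available
without the unprinted identification of the classes — machine-checked:
`gkp_criticalElement_tendsto_zero_of_identification` below (= faithful form + identification;
in unfolded form `gkp_criticalElement_tendsto_zero_of_pathSpace`, `GKPCompactnessPathSpace.lean`).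
*The faithful statement* (Prop. 2.2 over GKP's class, with `𝒟_c = IsGKPCriticalElement`; wanted
named fact `gkp_criticalElement_tendsto_zero_pathSpace`, hypothesis `h` of
`gkp_criticalElement_tendsto_zero_of_identification` verbatim):
`∀ {ν}, 0 < ν → ∀ {p} [Fact (1 ≤ p)], IsGKPExponent p → ∀ {T u U},
IsGKPCriticalElement ν p T u U → Tendsto U (𝓝[<] T) (𝓝 0)`.
*Original content (unchanged):* for `ν > 0`, a GKP exponent `p` and a critical element `(u, U)`
of the tree's class with lifespan `T` (`IsCriticalElement ν p T u U`), `U t → 0` in `𝓢'(ℝ³, ℂ³)`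
(Mathlib's weak-* topology of `TemperedDistribution`) as `t → T⁻` (function-valued data,
general viscosity as in `gkp_besov_blowup`). [cite: GKP2016, Prop. 2.2] -/
@[deprecated "mis-stated (2026-08-15): GKP Prop. 2.2 concerns 𝒟_c defined through NS(u₀) in the path space 𝓛^{1:∞}_p[T<T*] (its T* and A_c in that class), but this Prop reads its hypothesis (IsCriticalElement: IsMaximalBesovMildSolution + criticalBesovThreshold) over the tree's class (not a published uniqueness class); it is the faithful statement + the unprinted identification of the classes (gkp_criticalElement_tendsto_zero_of_identification). Faithful form: hypothesis `h` of Literature.Analysis.FluidPDE.gkp_criticalElement_tendsto_zero_of_identification (IsGKPCriticalElement ν p T u U → Tendsto U (𝓝[<] T) (𝓝 0)), wanted as named fact gkp_criticalElement_tendsto_zero_pathSpace" (since := "2026-08-15")]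
def gkp_criticalElement_tendsto_zero : Prop :=
  ∀ {ν : ℝ}, 0 < ν → ∀ {p : ℝ≥0∞} [Fact (1 ≤ p)], IsGKPExponent p → ∀ {T : ℝ}
    {u : ℝ → ℝ³ → ℝ³} {U : ℝ → 𝓢'(ℝ³, ℂ³)}, IsCriticalElement ν p T u U →
    Tendsto U (𝓝[<] T) (𝓝 0)

/-! ### Proposition 2.3 (rigidity of critical elements): retired as a named fact

GKP Proposition 2.3, "If `u₀` belongs to `Ḃ^{s_p}_{p,p}` with
`sup_{t ∈ [0,T*(u₀))} ‖NS(u₀)(t)‖_{Ḃ^{s_p}_{p,p}} < ∞` and if `NS(u₀)(t) → 0` in `𝓢'` as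
`t ↗ T*(u₀)`, then `T*(u₀) = ∞`" (§2.1, p. 6, under the standing assumption `p = q = 3·2^k - 2`,
`k ≥ 2`; proved in §2.5 from Prop. 2.8, `ε`-regularity, backward uniqueness and unique
continuation), used to be vendored here in the tree's rendering as a fourth named fact
`gkp_rigidity` (deprecated as mis-stated on 2026-08-15 like its three siblings above: in print the
statement concerns `NS(u₀)` in `𝓛^{1:∞}_p[T < T*]` and its maximal time in that class). On review
of the decomposition (2026-08-15, D-0026) it was **retired and merged back into the proof obligation
of its parent `gkp_besov_blowup`**, of which it is a corollary over one and the same class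
(`gkp_rigidity_of_gkp_besov_blowup`, `GKPCriticalElementsProofs.lean`; faithful forms:
`gkp_rigidity_pathSpace_of_blowup_pathSpace` below) and whose printed proof by contradiction it
closes (Step 3). Its statement is kept verbatim as the explicit hypothesis `h3` of the assembly
theorems of the next section: for `ν > 0`, GKP exponents `p` and `0 < T`,
`IsBesovMildSolutionOn (s_p) p p T ν u U → ⨆ t ∈ Ico 0 T, ‖U t‖_{Ḃ^{s_p}_{p,p}} < ∞ →
Tendsto U (𝓝[<] T) (𝓝 0) → ¬ IsMaximalBesovMildSolution (s_p) p p T ν u U`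
(module docstring, §"GKP's solution class versus the tree's class"). [cite: GKP2016, Prop. 2.3] -/

end Facts

/-! ## Theorem 1 from Propositions 2.1–2.3 -/

section Assembly

-- `linter.deprecated` is switched off for the next declaration only: it is a conditional
-- reduction over the tree's class whose hypotheses `h1`, `h2` are the deprecated (mis-stated)
-- renderings `gkp_exists_criticalElement` / `gkp_criticalElement_tendsto_zero`; kept unchanged for
-- its users.
set_option linter.deprecated false in
/-- **Props. 2.1–2.3 ⟹ Theorem 1 for `p = q = 3·2^k - 2`** (GKP 2016, §2.1: "Theorem 1 is an
immediate corollary of the next three statements"). If the critical norm of a maximal solution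
with finite lifespan `T` had finite supremum on `[0, T)`, then `A_c ≤ sup < ∞`
(`criticalBesovThreshold_le_biSup`), Prop. 2.1 (`h1`) gives a critical element, Prop. 2.2 (`h2`)
makes it tend to `0` in `𝓢'` at its blow-up time, and Prop. 2.3 (`h3`, its statement in the tree's
rendering: a Besov mild solution of the class `(s_p, p, p)` on `[0, T)`, `0 < T`, with bounded
critical norm and `U t → 0` in `𝓢'` as `t → T⁻` is not maximal — formerly the named fact
`gkp_rigidity`, retired as a corollary of the conclusion, `gkp_rigidity_of_gkp_besov_blowup`) says
it is not maximal — contradiction; so `sup_{[0,T)} ‖U t‖ = ∞`, and `limsup_{t → T⁻} ‖U t‖ = ∞` by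
continuity in `Ḃ^{s_p}_{p,p}` (`IsBesovMildSolutionOn.limsup_eq_top_of_biSup_eq_top`).
[cite: GKP2016, §2.1] -/
theorem limsup_eq_top_of_isGKPExponent (h1 : gkp_exists_criticalElement)
    (h2 : gkp_criticalElement_tendsto_zero)
    (h3 : ∀ {ν : ℝ}, 0 < ν → ∀ {p : ℝ≥0∞} [Fact (1 ≤ p)], IsGKPExponent p → ∀ {T : ℝ}, 0 < T →
      ∀ {u : ℝ → ℝ³ → ℝ³} {U : ℝ → 𝓢'(ℝ³, ℂ³)},
      IsBesovMildSolutionOn (-1 + 3 / p.toReal) p p T ν u U →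
      ⨆ t ∈ Ico 0 T, FunctionSpaces.eHomBesovNorm (-1 + 3 / p.toReal) p p (U t) < ∞ →
      Tendsto U (𝓝[<] T) (𝓝 0) →
      ¬ IsMaximalBesovMildSolution (-1 + 3 / p.toReal) p p T ν u U)
    {ν : ℝ} (hν : 0 < ν) {p : ℝ≥0∞} [Fact (1 ≤ p)] (hp : IsGKPExponent p) {T : ℝ} (hT : 0 < T)
    {u : ℝ → ℝ³ → ℝ³} {U : ℝ → 𝓢'(ℝ³, ℂ³)}
    (hmax : IsMaximalBesovMildSolution (-1 + 3 / p.toReal) p p T ν u U) :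
    limsup (fun t => FunctionSpaces.eHomBesovNorm (-1 + 3 / p.toReal) p p (U t)) (𝓝[<] T) = ∞ := by
  refine hmax.isBesovMildSolutionOn.limsup_eq_top_of_biSup_eq_top hp.one_le ?_
  by_contra hsup
  have hA : criticalBesovThreshold ν p < ∞ :=
    (criticalBesovThreshold_le_biSup hT hmax).trans_lt (lt_top_iff_ne_top.2 hsup)
  obtain ⟨T', u', U', hc⟩ := h1 hν hp hA
  exact h3 hν hp hc.pos hc.isMaximal.isBesovMildSolutionOn hc.biSup_lt_top (h2 hν hp hc)
    hc.isMaximal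

-- `linter.deprecated` is switched off for the next declaration only: it is a conditional
-- reduction over the tree's class whose hypotheses `h1`, `h2` are the deprecated (mis-stated)
-- renderings `gkp_exists_criticalElement` / `gkp_criticalElement_tendsto_zero`; kept unchanged for
-- its users.
set_option linter.deprecated false in
/-- For GKP exponents, Props. 2.1–2.3 (Prop. 2.3 as the explicit statement `h3`, see
`limsup_eq_top_of_isGKPExponent`) give `A_c = ∞` (GKP 2016, §2.1: Theorem 1 ⟺ `A_c = ∞`).
[cite: GKP2016, §2.1] -/
theorem criticalBesovThreshold_eq_top (h1 : gkp_exists_criticalElement)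
    (h2 : gkp_criticalElement_tendsto_zero)
    (h3 : ∀ {ν : ℝ}, 0 < ν → ∀ {p : ℝ≥0∞} [Fact (1 ≤ p)], IsGKPExponent p → ∀ {T : ℝ}, 0 < T →
      ∀ {u : ℝ → ℝ³ → ℝ³} {U : ℝ → 𝓢'(ℝ³, ℂ³)},
      IsBesovMildSolutionOn (-1 + 3 / p.toReal) p p T ν u U →
      ⨆ t ∈ Ico 0 T, FunctionSpaces.eHomBesovNorm (-1 + 3 / p.toReal) p p (U t) < ∞ →
      Tendsto U (𝓝[<] T) (𝓝 0) →
      ¬ IsMaximalBesovMildSolution (-1 + 3 / p.toReal) p p T ν u U)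
    {ν : ℝ} (hν : 0 < ν) {p : ℝ≥0∞} [Fact (1 ≤ p)] (hp : IsGKPExponent p) :
    criticalBesovThreshold ν p = ∞ :=
  criticalBesovThreshold_eq_top_of_biSup_eq_top fun _ _ _ hT hmax => eq_top_iff.2 <|
    (limsup_eq_top_of_isGKPExponent h1 h2 h3 hν hp hT hmax).symm.le.trans
      (limsup_nhdsLT_le_biSup_Ico hT)

-- `linter.deprecated` is switched off for the next declaration only: it is a conditional
-- reduction over the tree's class whose hypotheses are the deprecated (mis-stated) renderings
-- `gkp_regularity_persistence` / `gkp_exists_criticalElement`; kept unchanged for its users.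
set_option linter.deprecated false in
/-- **Maximality does not depend on `(p, q)`** (GKP 2016, §2.1 with (1.9)): a maximal Besov mild
solution in the class `(s_p, p, q)` is maximal in any larger critical class `(s_{p'}, p', q')`
into which `Ḃ^{s_p}_{p,q}` embeds with constant `C` — membership transfers along the embedding,
and an extension in the larger class would, by the persistence fact `gkp_regularity_persistence`
(hypothesis `h0`) applied with the initial distribution `V 0 = U 0 ∈ Ḃ^{s_p}_{p,q}`, be an
extension in the original class. [cite: GKP2016, (1.9)] -/
theorem IsMaximalBesovMildSolution.of_critical_embedding (h0 : gkp_regularity_persistence)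
    {ν : ℝ} (hν : 0 < ν) {p q p' q' : ℝ≥0∞} [Fact (1 ≤ p)] [Fact (1 ≤ p')] (hp₃ : 3 < p)
    (hp : p < ∞) (hq₃ : 3 < q) (hq : q < ∞) (hp'₃ : 3 < p') (hp' : p' < ∞) (hq'₃ : 3 < q')
    (hq' : q' < ∞) {C : ℝ≥0}
    (hC : ∀ w : 𝓢'(ℝ³, ℂ³),
      FunctionSpaces.eHomBesovNorm (-1 + 3 / p'.toReal) p' q' w ≤ C * FunctionSpaces.eHomBesovNorm (-1 + 3 / p.toReal) p q w)
    {T : ℝ} (hT : 0 < T) {u : ℝ → ℝ³ → ℝ³} {U : ℝ → 𝓢'(ℝ³, ℂ³)}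
    (hmax : IsMaximalBesovMildSolution (-1 + 3 / p.toReal) p q T ν u U) :
    IsMaximalBesovMildSolution (-1 + 3 / p'.toReal) p' q' T ν u U where
  isBesovMildSolutionOn := hmax.isBesovMildSolutionOn.of_norm_le hC
  not_extendable := by
    rintro ⟨T', hT', v, V, hv, hvu⟩
    have h0T : (0 : ℝ) ∈ Ico 0 T := ⟨le_rfl, hT⟩
    have hV0 : V 0 = U 0 :=
      (hv.isDistributionOf 0 ⟨le_rfl, hT.trans hT'⟩).unique
        ((hmax.isBesovMildSolutionOn.isDistributionOf 0 h0T).congr_ae (hvu 0 h0T).symm)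
    refine hmax.not_extendable ⟨T', hT', v, V,
      h0 hν hp₃ hp hq₃ hq hp'₃ hp' hq'₃ hq' (hT.trans hT') hv ?_, hvu⟩
    rw [hV0]
    exact hmax.isBesovMildSolutionOn.continuousInHomBesovOn.1 0 h0T

-- `linter.deprecated` is switched off for the next declaration only: it is a conditional
-- reduction over the tree's class whose hypotheses `h0`, `h1`, `h2` are the deprecated (mis-stated)
-- renderings `gkp_regularity_persistence` / `gkp_exists_criticalElement` /
-- `gkp_criticalElement_tendsto_zero` and whose conclusion is the deprecated rendering
-- `gkp_besov_blowup` (`CriticalRegularity.lean`); kept unchanged for its users.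
set_option linter.deprecated false in
/-- **GKP §2.1: Theorem 1 from (1.1), (1.9) and Propositions 2.1–2.3.** Given the Besov
embedding (BCD Prop. 2.20, `Literature.Analysis.FunctionSpaces.besov_embedding` on `𝓢'(ℝ³, ℂ³)`), the persistence fact
`gkp_regularity_persistence` ((1.9)) and the three propositions of §2.1 as hypotheses (Prop. 2.3
as the explicit statement `h3`, see `limsup_eq_top_of_isGKPExponent`), the named
fact `gkp_besov_blowup` (GKP 2016, Thm. 1, all `3 < p, q < ∞`) follows: choose a GKP exponent
`p' = 3·2^k - 2 ≥ max(p, q)` (`exists_isGKPExponent_ge`), embed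
`Ḃ^{s_p}_{p,q} ↪ Ḃ^{s_{p'}}_{p',p'}` (`exists_eHomBesovNorm_critical_le`), transfer maximality
(`IsMaximalBesovMildSolution.of_critical_embedding`), blow up in `Ḃ^{s_{p'}}_{p',p'}`
(`limsup_eq_top_of_isGKPExponent`) and pull the blow-up back along the embedding
(`limsup_eq_top_of_le_const_mul`). This is the printed reduction "one can prove Theorem 1 in
the case when `p = q`, and one can also choose `p` as large as needed". [cite: GKP2016, §2.1] -/
theorem gkp_besov_blowup_of_criticalElements (hE : FunctionSpaces.besov_embedding (E := ℝ³) (F := ℂ³))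
    (h0 : gkp_regularity_persistence) (h1 : gkp_exists_criticalElement)
    (h2 : gkp_criticalElement_tendsto_zero)
    (h3 : ∀ {ν : ℝ}, 0 < ν → ∀ {p : ℝ≥0∞} [Fact (1 ≤ p)], IsGKPExponent p → ∀ {T : ℝ}, 0 < T →
      ∀ {u : ℝ → ℝ³ → ℝ³} {U : ℝ → 𝓢'(ℝ³, ℂ³)},
      IsBesovMildSolutionOn (-1 + 3 / p.toReal) p p T ν u U →
      ⨆ t ∈ Ico 0 T, FunctionSpaces.eHomBesovNorm (-1 + 3 / p.toReal) p p (U t) < ∞ →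
      Tendsto U (𝓝[<] T) (𝓝 0) →
      ¬ IsMaximalBesovMildSolution (-1 + 3 / p.toReal) p p T ν u U) :
    gkp_besov_blowup := by
  intro ν hν p q _ hp₃ hp hq₃ hq T hT u U hmax
  obtain ⟨p', hp', hpp', hqp'⟩ := exists_isGKPExponent_ge hp hq
  haveI : Fact (1 ≤ p') := ⟨hp'.one_le⟩
  have hq0 : q ≠ 0 := (lt_trans (by norm_num) hq₃).ne'
  obtain ⟨C, hC⟩ := exists_eHomBesovNorm_critical_le hE hpp' hq0 hqp'
  have hmax' : IsMaximalBesovMildSolution (-1 + 3 / p'.toReal) p' p' T ν u U :=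
    hmax.of_critical_embedding h0 hν hp₃ hp hq₃ hq hp'.three_lt hp'.lt_top hp'.three_lt
      hp'.lt_top hC hT
  exact limsup_eq_top_of_le_const_mul (fun t => hC (U t))
    (limsup_eq_top_of_isGKPExponent h1 h2 h3 hν hp' hT hmax')

end Assembly

/-! ## The identification of the tree's class with `NS(u₀)`: what the deprecated facts add to the printed ones -/

section Identification

variable {ν : ℝ} {p q : ℝ≥0∞} [Fact (1 ≤ p)]

/-- Under the identification hypothesis `hId` at `(ν, p, q)` — every Besov mild solution of the
critical class `(s_p, p, q)` on `[0, T')`, `0 < T'`, lies in `𝓛^{1:∞}_{p,q}[T'' < T']` (the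
standing assumption of `CriticalRegularity.lean`; **not** a published result, see the module
docstring) — a Besov mild solution on `[0, T)`, `0 < T`, is a GKP solution (GKP 2016, (1.6): the
class of `NS(u₀)`). [cite: GKP2016, (1.6)] -/
theorem IsBesovMildSolutionOn.isGKPSolutionOn_of_identification
    (hId : ∀ ⦃T' : ℝ⦄, 0 < T' → ∀ ⦃v : ℝ → ℝ³ → ℝ³⦄ ⦃V : ℝ → 𝓢'(ℝ³, ℂ³)⦄,
      IsBesovMildSolutionOn (-1 + 3 / p.toReal) p q T' ν v V →
        ∀ T'' ∈ Ioo 0 T', FunctionSpaces.eGKPPathNorm 1 ∞ p q 0 T'' V < ∞)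
    {T : ℝ} (hT : 0 < T) {u : ℝ → ℝ³ → ℝ³} {U : ℝ → 𝓢'(ℝ³, ℂ³)}
    (h : IsBesovMildSolutionOn (-1 + 3 / p.toReal) p q T ν u U) : IsGKPSolutionOn p q T ν u U :=
  ⟨h, hId hT h⟩

/-- **Under the identification, the two maximality notions coincide** (GKP 2016, (1.3)): granted
`hId` at `(ν, p, q)`, a pair `(u, U)` on `[0, T)`, `0 < T`, is a maximal Besov mild solution of
the tree (`IsMaximalBesovMildSolution`, "`T = T*`" in the tree's class) iff it is a maximal GKP
solution (`IsMaximalGKPSolution`, "`T = T*(u₀)`" as printed): membership transfers by `hId`, a GKP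
extension is a Besov extension, and a Besov extension on `[0, T')`, `T' > T > 0`, is a GKP
extension by `hId` again. [cite: GKP2016, (1.3)] -/
theorem isMaximalBesovMildSolution_iff_isMaximalGKPSolution
    (hId : ∀ ⦃T' : ℝ⦄, 0 < T' → ∀ ⦃v : ℝ → ℝ³ → ℝ³⦄ ⦃V : ℝ → 𝓢'(ℝ³, ℂ³)⦄,
      IsBesovMildSolutionOn (-1 + 3 / p.toReal) p q T' ν v V →
        ∀ T'' ∈ Ioo 0 T', FunctionSpaces.eGKPPathNorm 1 ∞ p q 0 T'' V < ∞)
    {T : ℝ} (hT : 0 < T) {u : ℝ → ℝ³ → ℝ³} {U : ℝ → 𝓢'(ℝ³, ℂ³)} :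
    IsMaximalBesovMildSolution (-1 + 3 / p.toReal) p q T ν u U ↔ IsMaximalGKPSolution p q T ν u U :=
  ⟨fun h => ⟨h.isBesovMildSolutionOn.isGKPSolutionOn_of_identification hId hT,
      h.not_exists_gkp_extension⟩,
    fun h => ⟨h.isGKPSolutionOn.isBesovMildSolutionOn, fun ⟨T', hT', v, V, hv, hvu⟩ =>
      h.not_extendable ⟨T', hT', v, V, hv.isGKPSolutionOn_of_identification hId (hT.trans hT'),
        hvu⟩⟩⟩

/-- Under the identification at `(ν, p, p)`, the globality bounds of the tree and of GKP's class
are the same (their defining classes of blowing-up maximal solutions coincide,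
`isMaximalBesovMildSolution_iff_isMaximalGKPSolution`; GKP 2016, §2.1). [cite: GKP2016, §2.1] -/
theorem isGlobalityBound_iff_isGKPGlobalityBound
    (hId : ∀ ⦃T' : ℝ⦄, 0 < T' → ∀ ⦃v : ℝ → ℝ³ → ℝ³⦄ ⦃V : ℝ → 𝓢'(ℝ³, ℂ³)⦄,
      IsBesovMildSolutionOn (-1 + 3 / p.toReal) p p T' ν v V →
        ∀ T'' ∈ Ioo 0 T', FunctionSpaces.eGKPPathNorm 1 ∞ p p 0 T'' V < ∞)
    {A : ℝ≥0∞} : IsGlobalityBound ν p A ↔ IsGKPGlobalityBound ν p A :=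
  ⟨fun h _ _ _ hT hmax => h hT ((isMaximalBesovMildSolution_iff_isMaximalGKPSolution hId hT).2 hmax),
    fun h _ _ _ hT hmax => h hT ((isMaximalBesovMildSolution_iff_isMaximalGKPSolution hId hT).1 hmax)⟩

/-- **Under the identification, the two thresholds `A_c` coincide**: granted `hId` at `(ν, p, p)`,
`criticalBesovThreshold ν p` (the supremum of the globality bounds over the tree's class) equals
`gkpCriticalThreshold ν p` (the same supremum over GKP's class, i.e. `A_c` as printed, GKP 2016,
§2.1). [cite: GKP2016, §2.1] -/
theorem criticalBesovThreshold_eq_gkpCriticalThreshold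
    (hId : ∀ ⦃T' : ℝ⦄, 0 < T' → ∀ ⦃v : ℝ → ℝ³ → ℝ³⦄ ⦃V : ℝ → 𝓢'(ℝ³, ℂ³)⦄,
      IsBesovMildSolutionOn (-1 + 3 / p.toReal) p p T' ν v V →
        ∀ T'' ∈ Ioo 0 T', FunctionSpaces.eGKPPathNorm 1 ∞ p p 0 T'' V < ∞) :
    criticalBesovThreshold ν p = gkpCriticalThreshold ν p :=
  congrArg sSup (Set.ext fun _ => isGlobalityBound_iff_isGKPGlobalityBound hId)

/-- **Under the identification, the two sets `𝒟_c` coincide**: granted `hId` at `(ν, p, p)`,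
`(u, U)` with lifespan `T` is a critical element of the tree (`IsCriticalElement`) iff it is a
critical element over GKP's class (`IsGKPCriticalElement`, `𝒟_c` as printed, GKP 2016, §2.1):
maximality transfers (`isMaximalBesovMildSolution_iff_isMaximalGKPSolution`) and the thresholds
agree (`criticalBesovThreshold_eq_gkpCriticalThreshold`). [cite: GKP2016, §2.1] -/
theorem isCriticalElement_iff_isGKPCriticalElement
    (hId : ∀ ⦃T' : ℝ⦄, 0 < T' → ∀ ⦃v : ℝ → ℝ³ → ℝ³⦄ ⦃V : ℝ → 𝓢'(ℝ³, ℂ³)⦄,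
      IsBesovMildSolutionOn (-1 + 3 / p.toReal) p p T' ν v V →
        ∀ T'' ∈ Ioo 0 T', FunctionSpaces.eGKPPathNorm 1 ∞ p p 0 T'' V < ∞)
    {T : ℝ} {u : ℝ → ℝ³ → ℝ³} {U : ℝ → 𝓢'(ℝ³, ℂ³)} :
    IsCriticalElement ν p T u U ↔ IsGKPCriticalElement ν p T u U := by
  have hA := criticalBesovThreshold_eq_gkpCriticalThreshold hId
  constructor
  · intro h
    refine ⟨h.pos, (isMaximalBesovMildSolution_iff_isMaximalGKPSolution hId h.pos).1 h.isMaximal,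
      h.biSup_eq.trans hA, ?_⟩
    rw [← hA]
    exact h.threshold_lt_top
  · intro h
    refine ⟨h.pos, (isMaximalBesovMildSolution_iff_isMaximalGKPSolution hId h.pos).2 h.isMaximal,
      h.biSup_eq.trans hA.symm, ?_⟩
    rw [hA]
    exact h.threshold_lt_top

-- `linter.deprecated` is switched off for the next declaration only: its conclusion is the
-- deprecated (mis-stated) fact `gkp_regularity_persistence`, which this theorem dissects into the
-- printed statement and the unprinted identification (the machine-checked content of the
-- deprecation note).
set_option linter.deprecated false in
/-- **`gkp_regularity_persistence` = the printed (1.9) with (1.6) + the identification of the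
tree's class with `NS(u₀)`.** Hypothesis `h` is the faithful form of GKP 2016, (1.9) with (1.6),
over GKP's class (the wanted named fact `gkp_regularity_persistence_pathSpace`, verbatim): for a
GKP solution `(u, U)` on `[0, T)` in the class `(s_{p'}, p', q')` — hence `NS(u₀)` there, by the
uniqueness (1.6) — whose initial distribution lies in `Ḃ^{s_p}_{p,q}`, `T ≤ T*(u₀)` does not
depend on the exponents ((1.9)) and `NS(u₀)` is a GKP solution in the class `(s_p, p, q)` on
`[0, T)` ((1.6)), all exponents in `(3, ∞)`, any viscosity `ν > 0`. Hypothesis `hId` is the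
identification "every `IsBesovMildSolutionOn` solution lies in `𝓛^{1:∞}_{p,q}[T' < T]`"
(**not** a published result; literally the `hId` of `gkp_regularity_persistence_of_pathSpace`,
`GKPRegularityPersistence.lean`, with `MemGKPPathSpace` unfolded). Together they give the
deprecated fact exactly as stated; the proof is bookkeeping. [cite: GKP2016, (1.9) and (1.6)] -/
theorem gkp_regularity_persistence_of_identification
    (h : ∀ ⦃ν : ℝ⦄, 0 < ν → ∀ ⦃p q p' q' : ℝ≥0∞⦄ [Fact (1 ≤ p)] [Fact (1 ≤ p')], 3 < p → p < ∞ →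
      3 < q → q < ∞ → 3 < p' → p' < ∞ → 3 < q' → q' < ∞ → ∀ ⦃T : ℝ⦄, 0 < T →
      ∀ ⦃u : ℝ → ℝ³ → ℝ³⦄ ⦃U : ℝ → 𝓢'(ℝ³, ℂ³)⦄,
        IsGKPSolutionOn p' q' T ν u U → FunctionSpaces.MemHomBesov (-1 + 3 / p.toReal) p q (U 0) →
        IsGKPSolutionOn p q T ν u U)
    (hId : ∀ ⦃ν : ℝ⦄, 0 < ν → ∀ ⦃p q : ℝ≥0∞⦄ [Fact (1 ≤ p)], 3 < p → p < ∞ → 3 < q → q < ∞ →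
      ∀ ⦃T : ℝ⦄, 0 < T → ∀ ⦃u : ℝ → ℝ³ → ℝ³⦄ ⦃U : ℝ → 𝓢'(ℝ³, ℂ³)⦄,
        IsBesovMildSolutionOn (-1 + 3 / p.toReal) p q T ν u U →
          ∀ T' ∈ Ioo 0 T, FunctionSpaces.eGKPPathNorm 1 ∞ p q 0 T' U < ∞) :
    gkp_regularity_persistence := by
  intro ν hν p q p' q' _ _ hp₃ hp hq₃ hq hp'₃ hp' hq'₃ hq' T hT u U hu hU0
  exact (h hν hp₃ hp hq₃ hq hp'₃ hp' hq'₃ hq' hT ⟨hu, hId hν hp'₃ hp' hq'₃ hq' hT hu⟩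
    hU0).isBesovMildSolutionOn

-- `linter.deprecated` is switched off for the next declaration only: its conclusion is the
-- deprecated (mis-stated) fact `gkp_exists_criticalElement`, which this theorem dissects into the
-- printed Proposition 2.1 and the unprinted identification (the machine-checked content of the
-- deprecation note).
set_option linter.deprecated false in
/-- **`gkp_exists_criticalElement` = the printed Proposition 2.1 + the identification of the
tree's class with `NS(u₀)`.** Hypothesis `h` is GKP 2016, Prop. 2.1 over GKP's own class (the
wanted named fact `gkp_exists_criticalElement_pathSpace`, verbatim): for GKP exponents
`p = 3·2^k - 2` and any viscosity `ν > 0`, *if `A_c < ∞` (`gkpCriticalThreshold ν p < ∞`), then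
`𝒟_c ≠ ∅` (some `(u, U)` is a GKP critical element, `IsGKPCriticalElement ν p T u U`)*.
Hypothesis `hId` is the identification "every `IsBesovMildSolutionOn` solution lies in
`𝓛^{1:∞}_{p,q}[T' < T]`" (**not** a published result; literally the `hId` of
`gkp_exists_criticalElement_of_pathSpace`, `GKPCriticalElementsPathSpace.lean`, with
`MemGKPPathSpace` unfolded). Together they give the deprecated fact: under `hId` the two
thresholds agree (`criticalBesovThreshold_eq_gkpCriticalThreshold`), so `A_c < ∞` in the tree's
sense is `A_c < ∞` as printed, `h` yields a GKP critical element, and it is a critical element of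
the tree (`isCriticalElement_iff_isGKPCriticalElement`). [cite: GKP2016, Prop. 2.1] -/
theorem gkp_exists_criticalElement_of_identification
    (h : ∀ ⦃ν : ℝ⦄, 0 < ν → ∀ ⦃p : ℝ≥0∞⦄ [Fact (1 ≤ p)], IsGKPExponent p →
      gkpCriticalThreshold ν p < ∞ →
        ∃ (T : ℝ) (u : ℝ → ℝ³ → ℝ³) (U : ℝ → 𝓢'(ℝ³, ℂ³)), IsGKPCriticalElement ν p T u U)
    (hId : ∀ ⦃ν : ℝ⦄, 0 < ν → ∀ ⦃p q : ℝ≥0∞⦄ [Fact (1 ≤ p)], 3 < p → p < ∞ → 3 < q → q < ∞ →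
      ∀ ⦃T : ℝ⦄, 0 < T → ∀ ⦃u : ℝ → ℝ³ → ℝ³⦄ ⦃U : ℝ → 𝓢'(ℝ³, ℂ³)⦄,
        IsBesovMildSolutionOn (-1 + 3 / p.toReal) p q T ν u U →
          ∀ T' ∈ Ioo 0 T, FunctionSpaces.eGKPPathNorm 1 ∞ p q 0 T' U < ∞) :
    gkp_exists_criticalElement := by
  intro ν hν p _ hp hA
  -- the identification, specialised to the diagonal class `(s_p, p, p)` at this `(ν, p)`
  have hId' : ∀ ⦃T' : ℝ⦄, 0 < T' → ∀ ⦃v : ℝ → ℝ³ → ℝ³⦄ ⦃V : ℝ → 𝓢'(ℝ³, ℂ³)⦄,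
      IsBesovMildSolutionOn (-1 + 3 / p.toReal) p p T' ν v V →
        ∀ T'' ∈ Ioo 0 T', FunctionSpaces.eGKPPathNorm 1 ∞ p p 0 T'' V < ∞ :=
    fun T' hT' v V hv => hId hν hp.three_lt hp.lt_top hp.three_lt hp.lt_top hT' hv
  rw [criticalBesovThreshold_eq_gkpCriticalThreshold hId'] at hA
  obtain ⟨T, u, U, hc⟩ := h hν hp hA
  exact ⟨T, u, U, (isCriticalElement_iff_isGKPCriticalElement hId').2 hc⟩

-- `linter.deprecated` is switched off for the next declaration only: its conclusion is the
-- deprecated (mis-stated) fact `gkp_criticalElement_tendsto_zero`, which this theorem dissects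
-- into the printed Proposition 2.2 and the unprinted identification (the machine-checked content
-- of the deprecation note).
set_option linter.deprecated false in
/-- **`gkp_criticalElement_tendsto_zero` = the printed Proposition 2.2 + the identification of
the tree's class with `NS(u₀)`.** Hypothesis `h` is GKP 2016, Prop. 2.2 over GKP's own class (the
wanted named fact `gkp_criticalElement_tendsto_zero_pathSpace`, verbatim): for GKP exponents
`p = 3·2^k - 2` and any viscosity `ν > 0`, *every `u₀ ∈ 𝒟_c` (a GKP critical element `(u, U)`
with lifespan `T = T*(u₀)`, `IsGKPCriticalElement ν p T u U`, which carries `A_c < ∞` as printed)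
satisfies `NS(u₀)(t) → 0` in `𝓢'` as `t ↗ T*(u₀)`* (`Tendsto U (𝓝[<] T) (𝓝 0)`, Mathlib's
weak-* topology of `TemperedDistribution`; function-valued data by the device of §2.4, p. 8: the
time translates of a critical element are critical elements and are smooth by (1.6)). Hypothesis
`hId` is the identification "every `IsBesovMildSolutionOn` solution lies in
`𝓛^{1:∞}_{p,q}[T' < T]`" (**not** a published result; literally the `hId` of
`gkp_criticalElement_tendsto_zero_of_pathSpace`, `GKPCompactnessPathSpace.lean`, with
`MemGKPPathSpace` unfolded). Together they give the deprecated fact: under `hId` a critical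
element of the tree is a GKP critical element (`isCriticalElement_iff_isGKPCriticalElement`:
maximality transfers and the two thresholds `A_c` agree), to which `h` applies.
[cite: GKP2016, Prop. 2.2] -/
theorem gkp_criticalElement_tendsto_zero_of_identification
    (h : ∀ ⦃ν : ℝ⦄, 0 < ν → ∀ ⦃p : ℝ≥0∞⦄ [Fact (1 ≤ p)], IsGKPExponent p → ∀ ⦃T : ℝ⦄
      ⦃u : ℝ → ℝ³ → ℝ³⦄ ⦃U : ℝ → 𝓢'(ℝ³, ℂ³)⦄, IsGKPCriticalElement ν p T u U →
        Tendsto U (𝓝[<] T) (𝓝 0))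
    (hId : ∀ ⦃ν : ℝ⦄, 0 < ν → ∀ ⦃p q : ℝ≥0∞⦄ [Fact (1 ≤ p)], 3 < p → p < ∞ → 3 < q → q < ∞ →
      ∀ ⦃T : ℝ⦄, 0 < T → ∀ ⦃u : ℝ → ℝ³ → ℝ³⦄ ⦃U : ℝ → 𝓢'(ℝ³, ℂ³)⦄,
        IsBesovMildSolutionOn (-1 + 3 / p.toReal) p q T ν u U →
          ∀ T' ∈ Ioo 0 T, FunctionSpaces.eGKPPathNorm 1 ∞ p q 0 T' U < ∞) :
    gkp_criticalElement_tendsto_zero := by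
  intro ν hν p _ hp T u U hc
  -- the identification, specialised to the diagonal class `(s_p, p, p)` at this `(ν, p)`
  have hId' : ∀ ⦃T' : ℝ⦄, 0 < T' → ∀ ⦃v : ℝ → ℝ³ → ℝ³⦄ ⦃V : ℝ → 𝓢'(ℝ³, ℂ³)⦄,
      IsBesovMildSolutionOn (-1 + 3 / p.toReal) p p T' ν v V →
        ∀ T'' ∈ Ioo 0 T', FunctionSpaces.eGKPPathNorm 1 ∞ p p 0 T'' V < ∞ :=
    fun T' hT' v V hv => hId hν hp.three_lt hp.lt_top hp.three_lt hp.lt_top hT' hv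
  exact h hν hp ((isCriticalElement_iff_isGKPCriticalElement hId').1 hc)

/-- **The faithful Prop. 2.3 is a corollary of Theorem 1 over GKP's class** (local form). If every
maximal GKP solution of the class `(s_p, p, q)` with finite positive lifespan has
`limsup_{t → T⁻} ‖U t‖_{Ḃ^{s_p}_{p,q}} = ∞` (hypothesis `hT1`: GKP 2016, Thm. 1 read over
`IsMaximalGKPSolution` at this `(ν, p, q)`), then a pair `(u, U)` whose critical norm stays
bounded on `[0, T)`, `0 < T`, is not a maximal GKP solution with lifespan `T`
(`limsup ≤ sup < ∞`, `limsup_nhdsLT_le_biSup_Ico`). Twin, over GKP's class, of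
`gkp_besov_blowup.not_isMaximalBesovMildSolution_of_biSup_lt_top`
(`CriticalRegularityProofs.lean`). [cite: GKP2016, Thm. 1] -/
theorem not_isMaximalGKPSolution_of_biSup_lt_top
    (hT1 : ∀ ⦃T : ℝ⦄ ⦃u : ℝ → ℝ³ → ℝ³⦄ ⦃U : ℝ → 𝓢'(ℝ³, ℂ³)⦄, 0 < T →
      IsMaximalGKPSolution p q T ν u U →
        limsup (fun t => FunctionSpaces.eHomBesovNorm (-1 + 3 / p.toReal) p q (U t)) (𝓝[<] T) = ∞)
    {T : ℝ} (hT : 0 < T) {u : ℝ → ℝ³ → ℝ³} {U : ℝ → 𝓢'(ℝ³, ℂ³)}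
    (hsup : ⨆ t ∈ Ico 0 T, FunctionSpaces.eHomBesovNorm (-1 + 3 / p.toReal) p q (U t) < ∞) :
    ¬ IsMaximalGKPSolution p q T ν u U :=
  fun hmax => ((limsup_nhdsLT_le_biSup_Ico hT).trans_lt hsup).ne (hT1 hT hmax)

/-- **Prop. 2.3 over GKP's class from Theorem 1 over GKP's class.** Hypothesis `hT1` is GKP 2016,
Thm. 1 in its faithful form (every maximal GKP solution of the class `(s_p, p, q)`,
`3 < p, q < ∞`, with finite positive lifespan `T = T*(u₀)` has `limsup_{t → T⁻} ‖U t‖ = ∞`; any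
viscosity `ν > 0`, function-valued solutions; up to `memGKPPathSpace_iff`, the hypothesis `hP` of
`gkp_besov_blowup_of_pathSpaceBlowup`, `CriticalRegularityPathSpace.lean`); the conclusion is the
faithful Prop. 2.3 (hypothesis `h` of `gkp_rigidity_of_identification`, the wanted
`gkp_rigidity_pathSpace`), verbatim. In the paper Prop. 2.3 is Step 3 of the proof of Theorem 1;
logically it is the special case "`sup < ∞`" of it (the `𝓢'`-convergence hypothesis is not
used), which is what is recorded here — and why Prop. 2.3 is not a named fact of the tree (see the
module docstring: review of the decomposition). [cite: GKP2016, Prop. 2.3] -/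
theorem gkp_rigidity_pathSpace_of_blowup_pathSpace
    (hT1 : ∀ ⦃ν : ℝ⦄, 0 < ν → ∀ ⦃p q : ℝ≥0∞⦄ [Fact (1 ≤ p)], 3 < p → p < ∞ → 3 < q → q < ∞ →
      ∀ ⦃T : ℝ⦄, 0 < T → ∀ ⦃u : ℝ → ℝ³ → ℝ³⦄ ⦃U : ℝ → 𝓢'(ℝ³, ℂ³)⦄,
        IsMaximalGKPSolution p q T ν u U →
          limsup (fun t => FunctionSpaces.eHomBesovNorm (-1 + 3 / p.toReal) p q (U t)) (𝓝[<] T) = ∞) :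
    ∀ ⦃ν : ℝ⦄, 0 < ν → ∀ ⦃p : ℝ≥0∞⦄ [Fact (1 ≤ p)], IsGKPExponent p → ∀ ⦃T : ℝ⦄, 0 < T →
      ∀ ⦃u : ℝ → ℝ³ → ℝ³⦄ ⦃U : ℝ → 𝓢'(ℝ³, ℂ³)⦄, IsGKPSolutionOn p p T ν u U →
        ⨆ t ∈ Ico 0 T, FunctionSpaces.eHomBesovNorm (-1 + 3 / p.toReal) p p (U t) < ∞ →
        Tendsto U (𝓝[<] T) (𝓝 0) → ¬ IsMaximalGKPSolution p p T ν u U :=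
  fun _ hν _ _ hp _ hT _ _ _ hsup _ =>
    not_isMaximalGKPSolution_of_biSup_lt_top
      (fun _ _ _ hT' hmax => hT1 hν hp.three_lt hp.lt_top hp.three_lt hp.lt_top hT' hmax) hT hsup

/-- **Prop. 2.3 in the tree's rendering (`h3`) = the printed Proposition 2.3 + the identification
of the tree's class with `NS(u₀)`.** Hypothesis `h` is GKP 2016, Prop. 2.3 over GKP's own class
(the wanted named fact `gkp_rigidity_pathSpace`, verbatim): for GKP exponents `p = 3·2^k - 2` and
any viscosity `ν > 0`,
*a GKP solution `(u, U)` on `[0, T)`, `0 < T` (`NS(u₀)` there, by the uniqueness (1.6)), with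
`sup_{[0,T)} ‖U t‖_{Ḃ^{s_p}_{p,p}} < ∞` and `U t → 0` in `𝓢'` as `t → T⁻`, is not a maximal GKP
solution with lifespan `T`* (i.e. `T < T*(u₀)`: the printed "`T*(u₀) = ∞`" for a finite `T`;
function-valued solutions, Mathlib's weak-* topology of `TemperedDistribution` for `𝓢'`).
Hypothesis `hId` is the identification "every `IsBesovMildSolutionOn` solution lies in
`𝓛^{1:∞}_{p,q}[T' < T]`" (**not** a published result; literally the `hId` of
`gkp_rigidity_of_pathSpace`, `GKPRigidityProofs.lean`, with `MemGKPPathSpace` unfolded). Together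
they give Prop. 2.3 in the tree's rendering — the hypothesis `h3` of
`limsup_eq_top_of_isGKPExponent` / `gkp_besov_blowup_of_criticalElements`, i.e. the statement of
the former named fact `gkp_rigidity`, verbatim: a Besov mild solution of the tree satisfying the
two hypotheses is a GKP solution by `hId`
(`IsBesovMildSolutionOn.isGKPSolutionOn_of_identification`), so by `h` it has a GKP extension
past `T`, which is an extension in the tree's class
(`IsMaximalBesovMildSolution.not_exists_gkp_extension`). [cite: GKP2016, Prop. 2.3] -/
theorem gkp_rigidity_of_identification
    (h : ∀ ⦃ν : ℝ⦄, 0 < ν → ∀ ⦃p : ℝ≥0∞⦄ [Fact (1 ≤ p)], IsGKPExponent p → ∀ ⦃T : ℝ⦄, 0 < T →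
      ∀ ⦃u : ℝ → ℝ³ → ℝ³⦄ ⦃U : ℝ → 𝓢'(ℝ³, ℂ³)⦄, IsGKPSolutionOn p p T ν u U →
        ⨆ t ∈ Ico 0 T, FunctionSpaces.eHomBesovNorm (-1 + 3 / p.toReal) p p (U t) < ∞ →
        Tendsto U (𝓝[<] T) (𝓝 0) → ¬ IsMaximalGKPSolution p p T ν u U)
    (hId : ∀ ⦃ν : ℝ⦄, 0 < ν → ∀ ⦃p q : ℝ≥0∞⦄ [Fact (1 ≤ p)], 3 < p → p < ∞ → 3 < q → q < ∞ →
      ∀ ⦃T : ℝ⦄, 0 < T → ∀ ⦃u : ℝ → ℝ³ → ℝ³⦄ ⦃U : ℝ → 𝓢'(ℝ³, ℂ³)⦄,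
        IsBesovMildSolutionOn (-1 + 3 / p.toReal) p q T ν u U →
          ∀ T' ∈ Ioo 0 T, FunctionSpaces.eGKPPathNorm 1 ∞ p q 0 T' U < ∞) :
    ∀ {ν : ℝ}, 0 < ν → ∀ {p : ℝ≥0∞} [Fact (1 ≤ p)], IsGKPExponent p → ∀ {T : ℝ}, 0 < T →
      ∀ {u : ℝ → ℝ³ → ℝ³} {U : ℝ → 𝓢'(ℝ³, ℂ³)},
      IsBesovMildSolutionOn (-1 + 3 / p.toReal) p p T ν u U →
      ⨆ t ∈ Ico 0 T, FunctionSpaces.eHomBesovNorm (-1 + 3 / p.toReal) p p (U t) < ∞ →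
      Tendsto U (𝓝[<] T) (𝓝 0) →
      ¬ IsMaximalBesovMildSolution (-1 + 3 / p.toReal) p p T ν u U := by
  intro ν hν p _ hp T hT u U hu hsup hU hmax
  -- the identification, specialised to the diagonal class `(s_p, p, p)` at this `(ν, p)`
  have hId' : ∀ ⦃T' : ℝ⦄, 0 < T' → ∀ ⦃v : ℝ → ℝ³ → ℝ³⦄ ⦃V : ℝ → 𝓢'(ℝ³, ℂ³)⦄,
      IsBesovMildSolutionOn (-1 + 3 / p.toReal) p p T' ν v V →
        ∀ T'' ∈ Ioo 0 T', FunctionSpaces.eGKPPathNorm 1 ∞ p p 0 T'' V < ∞ :=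
    fun T' hT' v V hv => hId hν hp.three_lt hp.lt_top hp.three_lt hp.lt_top hT' hv
  exact h hν hp hT (hu.isGKPSolutionOn_of_identification hId' hT) hsup hU
    ((isMaximalBesovMildSolution_iff_isMaximalGKPSolution hId' hT).1 hmax)

/-- **Under the identification, Prop. 2.3 in the tree's rendering and the printed Proposition 2.3
are equivalent.** Granted `hId` ("every `IsBesovMildSolutionOn` solution lies in
`𝓛^{1:∞}_{p,q}[T' < T]`", **not** a published result), the tree-class rendering `h3` of Prop. 2.3
(the statement of the former named fact `gkp_rigidity`) holds iff GKP 2016, Prop. 2.3 over GKP's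
class does (hypothesis `h` of `gkp_rigidity_of_identification`, the wanted
`gkp_rigidity_pathSpace`): `←` is `gkp_rigidity_of_identification`; for `→`, a GKP solution is a
Besov mild solution of the tree and, under `hId`, maximality in GKP's class is maximality in the
tree's class (`isMaximalBesovMildSolution_iff_isMaximalGKPSolution`), which `h3` excludes.
Without `hId` neither direction is available (module docstring). [cite: GKP2016, Prop. 2.3] -/
theorem gkp_rigidity_iff_of_identification
    (hId : ∀ ⦃ν : ℝ⦄, 0 < ν → ∀ ⦃p q : ℝ≥0∞⦄ [Fact (1 ≤ p)], 3 < p → p < ∞ → 3 < q → q < ∞ →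
      ∀ ⦃T : ℝ⦄, 0 < T → ∀ ⦃u : ℝ → ℝ³ → ℝ³⦄ ⦃U : ℝ → 𝓢'(ℝ³, ℂ³)⦄,
        IsBesovMildSolutionOn (-1 + 3 / p.toReal) p q T ν u U →
          ∀ T' ∈ Ioo 0 T, FunctionSpaces.eGKPPathNorm 1 ∞ p q 0 T' U < ∞) :
    (∀ {ν : ℝ}, 0 < ν → ∀ {p : ℝ≥0∞} [Fact (1 ≤ p)], IsGKPExponent p → ∀ {T : ℝ}, 0 < T →
      ∀ {u : ℝ → ℝ³ → ℝ³} {U : ℝ → 𝓢'(ℝ³, ℂ³)},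
      IsBesovMildSolutionOn (-1 + 3 / p.toReal) p p T ν u U →
      ⨆ t ∈ Ico 0 T, FunctionSpaces.eHomBesovNorm (-1 + 3 / p.toReal) p p (U t) < ∞ →
      Tendsto U (𝓝[<] T) (𝓝 0) →
      ¬ IsMaximalBesovMildSolution (-1 + 3 / p.toReal) p p T ν u U) ↔
      ∀ ⦃ν : ℝ⦄, 0 < ν → ∀ ⦃p : ℝ≥0∞⦄ [Fact (1 ≤ p)], IsGKPExponent p → ∀ ⦃T : ℝ⦄, 0 < T →
        ∀ ⦃u : ℝ → ℝ³ → ℝ³⦄ ⦃U : ℝ → 𝓢'(ℝ³, ℂ³)⦄, IsGKPSolutionOn p p T ν u U →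
          ⨆ t ∈ Ico 0 T, FunctionSpaces.eHomBesovNorm (-1 + 3 / p.toReal) p p (U t) < ∞ →
          Tendsto U (𝓝[<] T) (𝓝 0) → ¬ IsMaximalGKPSolution p p T ν u U := by
  refine ⟨fun hR ν hν p _ hp T hT u U hu hsup hU hmax => ?_,
    fun h => gkp_rigidity_of_identification h hId⟩
  -- the identification, specialised to the diagonal class `(s_p, p, p)` at this `(ν, p)`
  have hId' : ∀ ⦃T' : ℝ⦄, 0 < T' → ∀ ⦃v : ℝ → ℝ³ → ℝ³⦄ ⦃V : ℝ → 𝓢'(ℝ³, ℂ³)⦄,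
      IsBesovMildSolutionOn (-1 + 3 / p.toReal) p p T' ν v V →
        ∀ T'' ∈ Ioo 0 T', FunctionSpaces.eGKPPathNorm 1 ∞ p p 0 T'' V < ∞ :=
    fun T' hT' v V hv => hId hν hp.three_lt hp.lt_top hp.three_lt hp.lt_top hT' hv
  exact hR hν hp hT hu.isBesovMildSolutionOn hsup hU
    ((isMaximalBesovMildSolution_iff_isMaximalGKPSolution hId' hT).2 hmax)

end Identification

end NS

end Literature.Analysis.FluidPDE
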